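import Literature.MathematicalPhysics.QuantumFieldTheory.Balaban1983to89.T3MinimiserStabilityReduction
import Literature.MathematicalPhysics.QuantumFieldTheory.Balaban1983to89.T3PrintedRegularMinimiser
import Literature.MathematicalPhysics.QuantumFieldTheory.Balaban1983to89.T3OrbitAverage
import Literature.MathematicalPhysics.QuantumFieldTheory.Balaban1983to89.B12ContinuousTransportInvariance
import Literature.MathematicalPhysics.QuantumFieldTheory.Balaban1983to89.Node00.CanonicalTransportOfRecord
import Literature.MathematicalPhysics.QuantumFieldTheory.Balaban1983to89.T3InteriorExcision
import Summits.QuantumFields.YangMills.Theorems.FluctuationComparisonRegPrIntLSupTailReduction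
import Summits.QuantumFields.YangMills.Theorems.FluctuationComparisonRegPrIntLSupTailDepthInduction
import Summits.QuantumFields.YangMills.Theorems.FluctuationComparisonRegPrIntLWreg
import HarnessLib

/-!
# LINE g22-1 «multistep_odds» — MULTI-STEP FIBRE CONCENTRATION: the interior large-field row LFR♯ᶜ∘ from per-level CONDITIONAL TAIL BOUNDS after ONE
# interior conditioning (ideator `ym-r3-idea-1` g22, LENS «control»; after ROW R3-FLIN ∕ FL-B (j337502, j337570, j337675) and critic #405∕#405b)

Crux of record: `stmt-QuantumFields-20520` = `Summit.QuantumFields.YangMills.Theses.UnitScaleTilt.FluctuationComparisonRegPrIntL`.  Target concluded BY NAME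
here: this file's `LargeFieldFourPtIntCan` (LFR♯ᶜ∘) — the text of LINE g21-3 `Lines/interior_table.lean` §1 (l.181–199) BYTE-IDENTICAL (local §0 `heightDensityCan`
∕ `fourPt` ∕ `fluctAtCan` ∕ `oneLoopFourPtCan` byte-identical too), so that in any file seeing both declarations the bridge is `Iff.rfl`; interior_table's PROVED
`fluctuationPartSmall_of_interiorTable : 1L4ᶜ∘ → H4ᶜ∘ → LFR♯ᶜ∘ → FluctuationPartSmall` then carries it to S2β (registry `Lines/semiclassical_s2beta.lean` §2).  The
registry is FROZEN (RULING №36∕37∕39): this is a PUBLISHED organ-level line, NOT registered; no `skeleton check` is run from this seat.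

THE LEVER (lens «control» — a controlling quantity per RG step).  The window odds `sup_{U ∈ W_J} log(g_univ ∕ g_hist)(U) ≤ τ_J` (TAILSUP) are what LFR♯ᶜ needs
besides locality (LINE g21-1's knit).  Two findings fix HOW they can be had at the binding blocks `L = 3, 5`:
 (1) R3-FLIN ∕ FL-B (certified, linearised one-step toy): `C(3) = 8.636 > 3^{3∕2}`, `C(5) = 12.08 > 5^{3∕2}` — a FULL-window datum's fibre minimiser may leave the next
     window, so every constant UNIFORM OVER THE FULL WINDOW for a `hist(b₀)`-relative quantity is exposed as typed (TAILSUP, TAILSUP₁, MOD₁, PPT; and — by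
     EXTENSIVITY of the good-history suppression at a globally staggered edge datum, `exp(−c·ρ_L·Vol_{J+1}·L·p(g_J)²)` with `Vol_{J+1} = 3(2L^{m+J+1})³`, `m` free —
     FAR₁ too; card `Lines/tailsup_one.md` v1.7).  On the `c`-INTERIOR `W_J(c·b₀)`, `c < c_max(L) = L^{3∕2}∕C(L)` (`0.602` at L = 3, `0.926` at L = 5, no price at
     L ≥ 6), the minimiser stays inside `W_{J+1}(b₀)` with room `θ_{J+1}(1 − c∕c_max)`.
 (2) THE FRACTION CANCELS BETWEEN CONSECUTIVE LEVELS: the LEAD's depth induction ✓`…SupTailDepthInduction.condGoodOdds_of_oneLevel` (FILE J) feeds the all-depth odds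
     from a ONE-LEVEL factor `hone` uniform over the level-`i` datum inside ITS window; conditioning level `i+1` on a level-`i` datum in `W_i(c_i·b₀)` is R3-FLIN-safe
     iff `c_i·C(L)∕L² < c_{i+1}·L^{−1∕2}`, i.e. `c_{i+1}∕c_i > C(L)∕L^{3∕2} = 1∕c_max(L) = 1.66` (L = 3), `1.08` (L = 5): the admissible fractions must GROW along the
     run and stay `≤ 1` — impossible beyond depth ≈ 2 at `L = 3, 5` (fine at `L ≥ 7`).  So at the binding blocks the all-depth interior odds CANNOT be fed level by
     level: one must condition ONCE, at level `J` on an interior datum, and control level `J + k` of the run DIRECTLY, around the `k`-STEP background.  The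
     controlling quantity is the `k`-step de-averaging ratio `C_k(L)∕L^{2k}` against the window ratio `θ_{J+k}∕θ_J = L^{−k∕2}·Π π`: for `k = 1` it is the interior
     price `c < c_max(L)`; for `k ≥ 2` the margin is `L^{3k∕2}∕C_k(L)` (conjecturally `C_k(L) ≈ C(L^k) ≤ 15 < 27 = 3³`: immune from `k = 2` on, IMPROVING with
     depth) — the instrument row R3-FLIN-2STEP (ASK below) decides `k = 2` at `L = 3`.

THE LINE.  LFR♯ᶜ∘ ⟸ (∘-knit, PROVED §5: port of g21-1's `largeFieldFourPtCan_of_split` with the common fraction `c := min cᵢ` and CRUDELOC read at profile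
`c·b₀` — CRUDELOC has no history, so it needs no ∘-version) 1L4ᶜ∘ + H4ᶜ∘ (interior_table, verbatim) + CRUDELOC (g21-1, verbatim) + TAILSUP∘ `WindowOddsSupIntCan`
(NEW: TAILSUP's text on the interior window, history at `b₀`, all depths); TAILSUP∘ ⟸ (door, PROVED §4: ✓A `…SupTailReduction` re-run on the interior window +
WREG ✓`windowRegularity`) COND-ODDS∘ `CondGoodOddsIntCan` (setwise conditional odds of a good history given an interior level-`J` event, all depths); COND-ODDS∘ ⟸
(PROVED §3: finite union bound over the free levels `J < j ≤ K` through ✓`mem_histGood_iff_descendTo`, super-polynomial tails summed by `tsum`, and the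
elementary odds step `μ(A) ≤ μ(A ∩ G) + σ·μ(A) ⇒ μ(A) ≤ e^{2σ}μ(A ∩ G)` for `σ ≤ ½`, else the positivity floor) MSTEP∘ `MultiStepTailIntCan` (per-level ABSOLUTE
conditional tail: given an interior level-`J` event, level `j` of the run leaves `W_j(b₀)` with conditional probability `≤ s_j`, `s` super-polynomial, uniformly
in the run length `K`) + POS∘ `GoodHistoryPositiveIntCan` (a `K`-uniform positive floor `q_J` of the conditional good-history probability — needed because the
torus exponent `F.m` is free after `γ₁`, so no `F`-uniform `Σ_j s_j ≤ ½` can hold and small `J` must be floored separately: DECOUPLING content, not a union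
bound); MSTEP∘ ⟸ (door, PROVED §3) MSTEP₁∘ `OneStepTailIntCan` (`j = J + 1`: the depth-one ABSOLUTE tail, far fields INCLUDED — the re-typed home of MOD₁∘ and of
the suspended FAR₁, critic #405 (A) decision (ii)) + DEEPSTEP∘ `DeepStepTailIntCan` (`j ≥ J + 2`: the multi-step rows, conjecturally immune to R3-FLIN at every `L`).

STUBS (6, §6): 1L4ᶜ∘, H4ᶜ∘ (interior_table's, verbatim — shared, not re-planned), CRUDELOC (g21-1's, verbatim — shared), MSTEP₁∘, DEEPSTEP∘, POS∘ (NEW).  Unique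
concluder `largeFieldFourPtIntCan_of_stubs : LargeFieldFourPtIntCan`.  `lean check`: rc 0, sorries = the 6 stubs, 0 elsewhere.

HONEST STATUS.  Nothing of Bałaban's is asserted; R3-FLIN ∕ FL-B are toy letters (GUIDANCE), honoured by the interior typing and named as the falsifier of DEEPSTEP∘;
1L4ᶜ∘ ∕ H4ᶜ∘ ∕ CRUDELOC ∕ MSTEP₁∘ ∕ DEEPSTEP∘ ∕ POS∘ ∕ LFR♯ᶜ∘ ∕ S2β ∕ 20520 are NOT proved; `YM3TorusSU2` is NOT proved; rung R3 — NOT d = 4, NOT infinite volume, NOT a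
mass gap, NOT Clay; no summit is proved by a line.
References: [Balaban1985UV3] (7) p.257, (38)–(41) p.266; [Balaban1985Averaging] (10) p.19, Prop. 1; [Balaban1985Variational] Thm 1 (8)–(10) p.279, Prop. 7 p.299;
[Balaban1989LargeFieldII] (1.77)–(1.79) p.383, (1.95) p.389; [Balaban1988Convergent] §2 (2.18)–(2.27); [King1986] Prop. 3.8–3.9.
-/

open MeasureTheory Filter Topology Set
open scoped ENNReal NNReal BigOperators
open Literature.MathematicalPhysics.QuantumFieldTheory.Balaban1983to89
open Literature.MathematicalPhysics.QuantumFieldTheory.Balaban1983to89.T3ContinuumYM3Torus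
open Literature.MathematicalPhysics.QuantumFieldTheory.Balaban1983to89.T3NestedUnitLaws
open Literature.MathematicalPhysics.QuantumFieldTheory.Balaban1983to89.T3UnitLawDensityEML
open Literature.MathematicalPhysics.QuantumFieldTheory.Balaban1983to89.T3UnitScaleTilt
open Literature.MathematicalPhysics.QuantumFieldTheory.Balaban1983to89.T3TiltDescent
open Literature.MathematicalPhysics.QuantumFieldTheory.Balaban1983to89.T3PrintedRegularMinimiser
open Literature.MathematicalPhysics.QuantumFieldTheory.Balaban1983to89.T3ConstrainedMinimiser (fibre)
open Literature.MathematicalPhysics.QuantumFieldTheory.Balaban1983to89.T3LevelShift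
open Literature.MathematicalPhysics.QuantumFieldTheory.Balaban1983to89.Missing
open Literature.MathematicalPhysics.QuantumFieldTheory.Balaban1983to89.T4Continuum
open Literature.MathematicalPhysics.QuantumFieldTheory.Balaban1983to89.T3DescentFibreTower
open scoped Literature.MathematicalPhysics.QuantumFieldTheory.Balaban1983to89.T3OrbitAverage
open Literature.MathematicalPhysics.QuantumFieldTheory.Balaban1983to89.T3InteriorExcision (θBal_mul θBal_mul_le)
open Summit.QuantumFields.YangMills.Theorems.FluctuationComparisonRegPrIntLWregAssembly (isOpen_setOf_plaqSmall₂)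
open Summit.QuantumFields.YangMills.Theorems.FluctuationComparisonRegPrIntLOddsLedgerVers (tower_eq_map_descendTo)
open Summit.QuantumFields.YangMills.Theorems.FluctuationComparisonRegPrIntLSupTailReduction (le_on_of_ae_le heightDensityCan_le_of_setwise heightDensityCan_univ_eqOn)
open Summit.QuantumFields.YangMills.Theorems.FluctuationComparisonRegPrIntLSupTailDepthInduction (mem_histGood_iff_descendTo)

noncomputable section

namespace Summit.QuantumFields.YangMills.Cruxes.FluctuationComparisonRegPrIntL.RunPairOrgan.MultiStepOdds

/-! ## §0 The canonical version, the connected 4-point, the λ-scaled fluctuation part (verbatim from registry v11.2a §1–§2 ∕ LINE g21-3 §0) -/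

section Canonical

variable (F : T3Family) (γ : ℝ) {J K : ℕ} (hJK : J ≤ K) (S : Set (GaugeField (F.P K) 0 (Matrix.specialUnitaryGroup (Fin 2) ℂ)))

/-- **THE CANONICAL VERSION OF BAŁABAN'S RESTRICTED DENSITY AT HEIGHT `K − J`** read on the `J`-th tower's finest lattice: the trunk's `heightDensity`
(a chosen Radon–Nikodym version) replaced by `Node00.canonVersion` of its a.e.-class for product Haar — continuous on the maximal open set carrying a
continuous representative and equal there to every such representative. [cite: Balaban1985UV3, (2) p.256 and (41) p.266] -/
def heightDensityCan (V : GaugeField (F.P J) 0 (Matrix.specialUnitaryGroup (Fin 2) ℂ)) : ℝ :=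
  Node00.canonVersion (fieldMeasure (F.P J) 0 (Matrix.specialUnitaryGroup (Fin 2) ℂ)) (heightDensity F γ hJK S) V

/-- The local `heightDensityCan` IS ✓`…WregGlue.heightDensityCan` (same text; `rfl`). [cite: Balaban1985UV3, (2) p.256] -/
theorem heightDensityCan_eq_wreg :
    heightDensityCan F γ hJK S = Summit.QuantumFields.YangMills.Theorems.FluctuationComparisonRegPrIntLWregGlue.heightDensityCan F γ hJK S := rfl

end Canonical

section Rows

/-- The connected 4-point (mixed second difference) — verbatim from v3a. [cite: Balaban1985UV3, (41) p.266] -/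
def fourPt {X : Type*} (f : X → ℝ) (U V W Z : X) : ℝ := (f U - f V) - (f W - f Z)

variable (F : T3Family) (γ b₀ p₀ ε₀ : ℝ) {J K : ℕ} (hJK : J ≤ K)

/-- **THE λ-SCALED FLUCTUATION PART OVER THE CANONICAL VERSION** `f^λ(V) := log heightDensityCan F (γ/λ) (histGood at θBal(γ)) V + β_K(γ/λ)·minActionRegPr(V)`.
[cite: Balaban1985UV3, (2) p.256 and (41) p.266] -/
def fluctAtCan (lam : ℝ) (V : GaugeField (F.P J) 0 (Matrix.specialUnitaryGroup (Fin 2) ℂ)) : ℝ :=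
  Real.log (heightDensityCan F (γ / lam) hJK (histGood F ℰp (θBal F.L γ b₀ p₀) K J) V)
    + (F.scheme ℰp (γ / lam)).β K * minActionRegPr F J K hJK ε₀ V

/-- **THE CANONICAL ONE-LOOP 4-POINT** `Λ₄ := lim_{λ→∞} Δ² f^λ` over the canonical version (junk if the limit does not exist; 1L4ᶜ asserts it does).
[cite: Balaban1985Variational, Thm 1 (8)-(10) p.279] -/
def oneLoopFourPtCan (U V W Z : GaugeField (F.P J) 0 (Matrix.specialUnitaryGroup (Fin 2) ℂ)) : ℝ :=
  limUnder atTop (fun lam : ℝ => fourPt (fluctAtCan F γ b₀ p₀ ε₀ hJK lam) U V W Z)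

/-- At `λ = 1`: S2β's integrand with the canonical small-history density. [cite: Balaban1985UV3, (41) p.266] -/
theorem fluctAtCan_one (V : GaugeField (F.P J) 0 (Matrix.specialUnitaryGroup (Fin 2) ℂ)) :
    fluctAtCan F γ b₀ p₀ ε₀ hJK 1 V =
      Real.log (heightDensityCan F γ hJK (histGood F ℰp (θBal F.L γ b₀ p₀) K J) V)
        + (F.scheme ℰp γ).β K * minActionRegPr F J K hJK ε₀ V := by
  simp only [fluctAtCan, div_one]

/-! ## §1 ROWS OF RECORD, VERBATIM: 1L4ᶜ∘, H4ᶜ∘, LFR♯ᶜ∘ (LINE g21-3 `Lines/interior_table.lean` §1), CRUDELOC (LINE g21-1 `Lines/suptail_split.lean` §1) -/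

/-- **1L4ᶜ∘ · ONE-LOOP 4-POINTS EXIST AND ARE CLUSTERED — INTERIOR WINDOW.** Registry v11.2a's `OneLoopClusteredCan` with `∃ c₀ : ℝ, 0 < c₀ ∧ c₀ ≤ 1 ∧ ∀ (c : ℝ),
0 < c → c ≤ c₀ →` inserted after `∀ (L : ℕ),` and every WINDOW clause `PlaqSmall (θBal F.L γ b₀ p₀ J) ·` (the regular-set inclusion (R), the positivity
(P), the four quadrilateral data of (T)) read at `θBal F.L γ (c * b₀) p₀ J`; the HISTORY `histGood F ℰp (θBal F.L γ b₀ p₀) K J` inside `heightDensity(Can)`,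
`fluctAtCan`, `oneLoopFourPtCan` UNCHANGED.  Why it might fail: as 1L4ᶜ (the semiclassical limit (T) needs the fibre minimiser inside the history — now
granted by the choice of `c(L)`, R3-FLIN: `c(3) < 0.61` in the toy); (R) is honest analytic content. [cite: Balaban1985Variational, Thm 1 (8)-(10) p.279;
Balaban1985Averaging, (10) p.19; King1986, Prop. 3.8-3.9] -/
def OneLoopClusteredIntCan : Prop :=
  ∀ (L : ℕ), ∃ c₀ : ℝ, 0 < c₀ ∧ c₀ ≤ 1 ∧ ∀ (c : ℝ), 0 < c → c ≤ c₀ → ∃ pS : ℝ, ∀ (b₀ p₀ : ℝ), 0 < b₀ → pS ≤ p₀ → 0 < p₀ → ∃ ε₁ : ℝ, 0 < ε₁ ∧ ∀ (ε₀ : ℝ), 0 < ε₀ → ε₀ ≤ ε₁ →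
    ∃ γ₁ : ℝ, 0 < γ₁ ∧ ∃ κ : ℝ, 0 < κ ∧ ∀ (F : T3Family) (γ : ℝ), F.L = L → 0 < γ → γ ≤ γ₁ →
      ∃ φ₁ : ℕ → ℝ, (∀ J, 0 ≤ φ₁ J) ∧ Tendsto (fun J : ℕ => (J : ℝ) * φ₁ J) atTop (𝓝 0) ∧
        ∀ (J K : ℕ) (hJK : J ≤ K),
          (∀ lam : ℝ, 1 ≤ lam →
            {U : GaugeField (F.P J) 0 (Matrix.specialUnitaryGroup (Fin 2) ℂ) | PlaqSmall (θBal F.L γ (c * b₀) p₀ J) U} ⊆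
              Node00.regSet (fieldMeasure (F.P J) 0 (Matrix.specialUnitaryGroup (Fin 2) ℂ))
                (heightDensity F (γ / lam) hJK (histGood F ℰp (θBal F.L γ b₀ p₀) K J))) ∧
          (∀ lam : ℝ, 1 ≤ lam → ∀ U : GaugeField (F.P J) 0 (Matrix.specialUnitaryGroup (Fin 2) ℂ), PlaqSmall (θBal F.L γ (c * b₀) p₀ J) U →
              0 < heightDensityCan F (γ / lam) hJK (histGood F ℰp (θBal F.L γ b₀ p₀) K J) U) ∧
          ∀ (b b' : PBond (F.P J) 0) (U V W Z : GaugeField (F.P J) 0 (Matrix.specialUnitaryGroup (Fin 2) ℂ)),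
            PlaqSmall (θBal F.L γ (c * b₀) p₀ J) U → PlaqSmall (θBal F.L γ (c * b₀) p₀ J) V →
            PlaqSmall (θBal F.L γ (c * b₀) p₀ J) W → PlaqSmall (θBal F.L γ (c * b₀) p₀ J) Z →
            (∀ e, e ≠ b → U e = V e) → (∀ e, e ≠ b' → U e = W e) → (∀ e, e ≠ b' → V e = Z e) → (∀ e, e ≠ b → W e = Z e) →
            Tendsto (fun lam : ℝ => fourPt (fluctAtCan F γ b₀ p₀ ε₀ hJK lam) U V W Z) atTop
                (𝓝 (oneLoopFourPtCan F γ b₀ p₀ ε₀ hJK U V W Z)) ∧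
              |oneLoopFourPtCan F γ b₀ p₀ ε₀ hJK U V W Z| ≤ φ₁ J * Real.exp (-(κ * (b.src.tdist b'.src : ℝ)))

/-- **H4ᶜ∘ · BEYOND ONE LOOP — INTERIOR WINDOW.** Registry v11.2a's `BeyondOneLoopSmallCan` with the same two textual moves (shared-shape fraction after
`∀ L`; the four quadrilateral window clauses at `c * b₀`; `fluctAtCan`∕`oneLoopFourPtCan` keep the history profile `b₀`).  Why it might fail: on interior data
the `λ = 1` vs `λ = ∞` difference is a genuine two-loop remainder `O(g_K²)` per localisation — Bałaban's (45)–(47); at small `L` only for `c ≤ c(L)`.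
[cite: Balaban1985UV3, (45)-(47) p.267; Balaban1987RG1, Thm 1 (0.19)-(0.26)] -/
def BeyondOneLoopSmallIntCan : Prop :=
  ∀ (L : ℕ), ∃ c₀ : ℝ, 0 < c₀ ∧ c₀ ≤ 1 ∧ ∀ (c : ℝ), 0 < c → c ≤ c₀ → ∃ pS : ℝ, ∀ (b₀ p₀ : ℝ), 0 < b₀ → pS ≤ p₀ → 0 < p₀ → ∃ ε₁ : ℝ, 0 < ε₁ ∧ ∀ (ε₀ : ℝ), 0 < ε₀ → ε₀ ≤ ε₁ →
    ∃ γ₁ : ℝ, 0 < γ₁ ∧ ∃ κ : ℝ, 0 < κ ∧ ∀ (F : T3Family) (γ : ℝ), F.L = L → 0 < γ → γ ≤ γ₁ →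
      ∃ φ₂ : ℕ → ℝ, (∀ J, 0 ≤ φ₂ J) ∧ Tendsto (fun J : ℕ => (J : ℝ) * φ₂ J) atTop (𝓝 0) ∧
        ∀ (J K : ℕ) (hJK : J ≤ K) (b b' : PBond (F.P J) 0) (U V W Z : GaugeField (F.P J) 0 (Matrix.specialUnitaryGroup (Fin 2) ℂ)),
          PlaqSmall (θBal F.L γ (c * b₀) p₀ J) U → PlaqSmall (θBal F.L γ (c * b₀) p₀ J) V →
          PlaqSmall (θBal F.L γ (c * b₀) p₀ J) W → PlaqSmall (θBal F.L γ (c * b₀) p₀ J) Z →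
          (∀ e, e ≠ b → U e = V e) → (∀ e, e ≠ b' → U e = W e) → (∀ e, e ≠ b' → V e = Z e) → (∀ e, e ≠ b → W e = Z e) →
          |fourPt (fluctAtCan F γ b₀ p₀ ε₀ hJK 1) U V W Z - oneLoopFourPtCan F γ b₀ p₀ ε₀ hJK U V W Z|
            ≤ φ₂ J * Real.exp (-(κ * (b.src.tdist b'.src : ℝ)))

/-- **LFR♯ᶜ∘ · LARGE-FIELD 4-POINT REMAINDER — INTERIOR WINDOW.** Registry v11.2a's `LargeFieldFourPtCan` with the same two textual moves: the version `ρ`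
is positive and continuous on the INTERIOR window `{PlaqSmall (θBal F.L γ (c * b₀) p₀ J)}`, the canonical `hist(b₀)` density is positive there, and the
connected 4-points of `log ρ − log heightDensityCan^{histGood(b₀)}` at INTERIOR quadrilaterals are `≤ ψ J e^{−κ d}`.  Why it might fail: the large-field
polymer expansion's smallness per history cell is print ([Balaban1988Convergent] §2) but its 4-point clustering across `∂BL_J` is exactly what the full-window
row got wrong at `L = 3`; on the `c`-interior the boundary layer is excised by the choice of `c(L)`. [cite: Balaban1988Convergent, §2 (2.18)-(2.27);
Balaban1989LargeFieldI, §1; King1986, Prop. 3.8-3.9] -/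
def LargeFieldFourPtIntCan : Prop :=
  ∀ (L : ℕ), ∃ c₀ : ℝ, 0 < c₀ ∧ c₀ ≤ 1 ∧ ∀ (c : ℝ), 0 < c → c ≤ c₀ → ∃ pS : ℝ, ∀ (b₀ p₀ : ℝ), 0 < b₀ → pS ≤ p₀ → 0 < p₀ →
    ∃ γ₁ : ℝ, 0 < γ₁ ∧ ∃ κ : ℝ, 0 < κ ∧ ∀ (F : T3Family) (γ : ℝ), F.L = L → 0 < γ → γ ≤ γ₁ →
      ∃ ψ : ℕ → ℝ, (∀ J, 0 ≤ ψ J) ∧ Tendsto (fun J : ℕ => (J : ℝ) * ψ J) atTop (𝓝 0) ∧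
        ∀ (ν : ℕ → (j : ℕ) → Measure (GaugeField (F.P j) 0 (Matrix.specialUnitaryGroup (Fin 2) ℂ))),
          (∀ K, ν K K = T4GenFunBounds.gibbsMeasure (F.P K) ((F.scheme ℰp γ).β K)) →
          (∀ K j, j < K → ν K j = Measure.map (descend F ℰp j) (ν K (j + 1))) →
          ∀ (J K : ℕ) (hJK : J ≤ K) (ρ : GaugeField (F.P J) 0 (Matrix.specialUnitaryGroup (Fin 2) ℂ) → ℝ),
            (∀ U, PlaqSmall (θBal F.L γ (c * b₀) p₀ J) U → 0 < ρ U) →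
            ν K J = (fieldMeasure _ _ _).withDensity (fun U => ENNReal.ofReal (ρ U)) →
            ContinuousOn ρ {U | PlaqSmall (θBal F.L γ (c * b₀) p₀ J) U} →
            (∀ U : GaugeField (F.P J) 0 (Matrix.specialUnitaryGroup (Fin 2) ℂ), PlaqSmall (θBal F.L γ (c * b₀) p₀ J) U →
                0 < heightDensityCan F γ hJK (histGood F ℰp (θBal F.L γ b₀ p₀) K J) U) →
            ∀ (b b' : PBond (F.P J) 0) (U V W Z : GaugeField (F.P J) 0 (Matrix.specialUnitaryGroup (Fin 2) ℂ)),
              PlaqSmall (θBal F.L γ (c * b₀) p₀ J) U → PlaqSmall (θBal F.L γ (c * b₀) p₀ J) V →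
              PlaqSmall (θBal F.L γ (c * b₀) p₀ J) W → PlaqSmall (θBal F.L γ (c * b₀) p₀ J) Z →
              (∀ e, e ≠ b → U e = V e) → (∀ e, e ≠ b' → U e = W e) → (∀ e, e ≠ b' → V e = Z e) → (∀ e, e ≠ b → W e = Z e) →
              |fourPt (fun U => Real.log (ρ U) - Real.log (heightDensityCan F γ hJK (histGood F ℰp (θBal F.L γ b₀ p₀) K J) U)) U V W Z|
                ≤ ψ J * Real.exp (-(κ * (b.src.tdist b'.src : ℝ)))

/-- **CRUDELOC · UNIFORM CRUDE LOCALITY OF THE FULL EFFECTIVE ACTION IN 4-POINT CURRENCY** (LINE g21-1 `CrudeLocalityCan`, text VERBATIM): the connected 4-points of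
`log ρ + β_K·minActionRegPr` at window quadrilaterals are `≤ C_J·e^{−κ d(b,b′)}` with a POLYNOMIALLY BOUNDED family `C_J ≤ C₀(J+1)^a`, uniformly in the depth `K`
(locality WITHOUT smallness).  It carries NO history, so the ∘-knit reads it at the profile `c·b₀` (its window is then the interior window) — no ∘-version is owed.
WHY IT MIGHT FAIL: uniform-in-`K` exponential clustering of the FULL density's 4-points through large-field regions of the fine levels is the localization half of
the R∕T-operation induction — XL, in print only inside the whole inductive scheme. [cite: Balaban1989LargeFieldII, (1.66)-(1.67) p.376 and (1.95) p.389;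
Balaban1988Convergent, §2 (2.18)-(2.27); Balaban1985UV3, Thm 2 p.263 and (41) p.266; Balaban1984PropagatorsI, Thm 1] -/
def CrudeLocalityCan : Prop :=
  ∀ (L : ℕ), ∃ pS : ℝ, ∀ (b₀ p₀ : ℝ), 0 < b₀ → pS ≤ p₀ → 0 < p₀ → ∃ ε₁ : ℝ, 0 < ε₁ ∧ ∀ (ε₀ : ℝ), 0 < ε₀ → ε₀ ≤ ε₁ →
    ∃ γ₁ : ℝ, 0 < γ₁ ∧ ∃ κ : ℝ, 0 < κ ∧ ∀ (F : T3Family) (γ : ℝ), F.L = L → 0 < γ → γ ≤ γ₁ →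
      ∃ (C : ℕ → ℝ), (∀ J, 0 ≤ C J) ∧ (∃ (a : ℕ) (C₀ : ℝ), ∀ J, C J ≤ C₀ * ((J : ℝ) + 1) ^ a) ∧
        ∀ (ν : ℕ → (j : ℕ) → Measure (GaugeField (F.P j) 0 (Matrix.specialUnitaryGroup (Fin 2) ℂ))),
          (∀ K, ν K K = T4GenFunBounds.gibbsMeasure (F.P K) ((F.scheme ℰp γ).β K)) →
          (∀ K j, j < K → ν K j = Measure.map (descend F ℰp j) (ν K (j + 1))) →
          ∀ (J K : ℕ) (hJK : J ≤ K) (ρ : GaugeField (F.P J) 0 (Matrix.specialUnitaryGroup (Fin 2) ℂ) → ℝ),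
            (∀ U, PlaqSmall (θBal F.L γ b₀ p₀ J) U → 0 < ρ U) →
            ν K J = (fieldMeasure _ _ _).withDensity (fun U => ENNReal.ofReal (ρ U)) →
            ContinuousOn ρ {U | PlaqSmall (θBal F.L γ b₀ p₀ J) U} →
            ∀ (b b' : PBond (F.P J) 0) (U V W Z : GaugeField (F.P J) 0 (Matrix.specialUnitaryGroup (Fin 2) ℂ)),
              PlaqSmall (θBal F.L γ b₀ p₀ J) U → PlaqSmall (θBal F.L γ b₀ p₀ J) V →
              PlaqSmall (θBal F.L γ b₀ p₀ J) W → PlaqSmall (θBal F.L γ b₀ p₀ J) Z →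
              (∀ e, e ≠ b → U e = V e) → (∀ e, e ≠ b' → U e = W e) → (∀ e, e ≠ b' → V e = Z e) → (∀ e, e ≠ b → W e = Z e) →
              |((Real.log (ρ U) + (F.scheme ℰp γ).β K * minActionRegPr F J K hJK ε₀ U)
                  - (Real.log (ρ V) + (F.scheme ℰp γ).β K * minActionRegPr F J K hJK ε₀ V))
                - ((Real.log (ρ W) + (F.scheme ℰp γ).β K * minActionRegPr F J K hJK ε₀ W)
                  - (Real.log (ρ Z) + (F.scheme ℰp γ).β K * minActionRegPr F J K hJK ε₀ Z))|
                ≤ C J * Real.exp (-(κ * (b.src.tdist b'.src : ℝ)))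

/-! ## §2 THE NEW ROWS: TAILSUP∘, COND-ODDS∘, MSTEP∘ ⟸ MSTEP₁∘ + DEEPSTEP∘, POS∘ (interior window `θBal F.L γ (c * b₀) p₀ J`, history at `b₀`, shared-shape fraction) -/

/-- **TAILSUP∘ · FIBREWISE WINDOW ODDS — INTERIOR WINDOW, ALL DEPTHS** (`WindowOddsSupIntCan`): LINE g21-1's TAILSUP `WindowOddsSupCan` with the shared-shape fraction
`∃ c₀, 0 < c₀ ∧ c₀ ≤ 1 ∧ ∀ c, 0 < c → c ≤ c₀ →` after `∀ L` and its five WINDOW clauses (ρ-positivity, ρ-continuity, canonical `hist(b₀)`-density positivity, the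
conclusion's datum) read at `θBal F.L γ (c * b₀) p₀ J`; the HISTORY stays at `b₀`: for every continuous positive interior-window version `ρ` of the level-`J` law
there is a constant `a₀` with `0 ≤ log ρ U − a₀ − log heightDensityCan^{histGood(b₀)} U ≤ τ_J` at every INTERIOR datum, `τ` super-polynomial, uniformly in `K`.
WHY IT MIGHT FAIL: as TAILSUP one level down (COND-ODDS∘): the conditional probability of a `b₀`-good history given an interior level-`J` datum must be `≥ e^{−τ_J}`
uniformly in the depth — at `L = 3, 5` NOT obtainable level by level (module docstring (2)); the multi-step rows DEEPSTEP∘ are uncharted in print beyond Bałaban's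
inductive R-operation. [cite: Balaban1989LargeFieldII, (1.77)-(1.79) p.383 and (1.95) p.389; Balaban1985UV3, (38)-(40) p.266] -/
def WindowOddsSupIntCan : Prop :=
  ∀ (L : ℕ), ∃ c₀ : ℝ, 0 < c₀ ∧ c₀ ≤ 1 ∧ ∀ (c : ℝ), 0 < c → c ≤ c₀ → ∃ pS : ℝ, ∀ (b₀ p₀ : ℝ), 0 < b₀ → pS ≤ p₀ → 0 < p₀ →
    ∃ γ₁ : ℝ, 0 < γ₁ ∧ ∀ (F : T3Family) (γ : ℝ), F.L = L → 0 < γ → γ ≤ γ₁ →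
      ∃ τ : ℕ → ℝ, (∀ J, 0 ≤ τ J) ∧ (∀ a : ℕ, Tendsto (fun J : ℕ => ((J : ℝ) + 1) ^ a * τ J) atTop (𝓝 0)) ∧
        ∀ (ν : ℕ → (j : ℕ) → Measure (GaugeField (F.P j) 0 (Matrix.specialUnitaryGroup (Fin 2) ℂ))),
          (∀ K, ν K K = T4GenFunBounds.gibbsMeasure (F.P K) ((F.scheme ℰp γ).β K)) →
          (∀ K j, j < K → ν K j = Measure.map (descend F ℰp j) (ν K (j + 1))) →
          ∀ (J K : ℕ) (hJK : J ≤ K) (ρ : GaugeField (F.P J) 0 (Matrix.specialUnitaryGroup (Fin 2) ℂ) → ℝ),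
            (∀ U, PlaqSmall (θBal F.L γ (c * b₀) p₀ J) U → 0 < ρ U) →
            ν K J = (fieldMeasure _ _ _).withDensity (fun U => ENNReal.ofReal (ρ U)) →
            ContinuousOn ρ {U | PlaqSmall (θBal F.L γ (c * b₀) p₀ J) U} →
            (∀ U : GaugeField (F.P J) 0 (Matrix.specialUnitaryGroup (Fin 2) ℂ), PlaqSmall (θBal F.L γ (c * b₀) p₀ J) U →
                0 < heightDensityCan F γ hJK (histGood F ℰp (θBal F.L γ b₀ p₀) K J) U) →
            ∃ a₀ : ℝ, ∀ U : GaugeField (F.P J) 0 (Matrix.specialUnitaryGroup (Fin 2) ℂ), PlaqSmall (θBal F.L γ (c * b₀) p₀ J) U →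
              0 ≤ Real.log (ρ U) - a₀ - Real.log (heightDensityCan F γ hJK (histGood F ℰp (θBal F.L γ b₀ p₀) K J) U) ∧
              Real.log (ρ U) - a₀ - Real.log (heightDensityCan F γ hJK (histGood F ℰp (θBal F.L γ b₀ p₀) K J) U) ≤ τ J

/-- **COND-ODDS∘ · SETWISE CONDITIONAL ODDS OF A GOOD HISTORY GIVEN AN INTERIOR LEVEL-`J` EVENT, ALL DEPTHS** (`CondGoodOddsIntCan`): for every measurable `B` inside the
INTERIOR window, `Gibbs_K(D_{J,K}⁻¹B) ≤ e^{τ_J}·Gibbs_K(D_{J,K}⁻¹B ∩ histGood(b₀) K J)`, `τ` super-polynomial, uniformly in `K` — ✓A's hypothesis shape on the interior.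
PROVED below from MSTEP∘ + POS∘ (§3); kept as a named row because it is the natural currency of the door §4.  WHY IT MIGHT FAIL: only through MSTEP∘ ∕ POS∘.
[cite: Balaban1985UV3, (38)-(40) p.266; Balaban1989LargeFieldII, (1.77)-(1.79) p.383] -/
def CondGoodOddsIntCan : Prop :=
  ∀ (L : ℕ), ∃ c₀ : ℝ, 0 < c₀ ∧ c₀ ≤ 1 ∧ ∀ (c : ℝ), 0 < c → c ≤ c₀ → ∃ pS : ℝ, ∀ (b₀ p₀ : ℝ), 0 < b₀ → pS ≤ p₀ → 0 < p₀ →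
    ∃ γ₁ : ℝ, 0 < γ₁ ∧ ∀ (F : T3Family) (γ : ℝ), F.L = L → 0 < γ → γ ≤ γ₁ →
      ∃ τ : ℕ → ℝ, (∀ J, 0 ≤ τ J) ∧ (∀ a : ℕ, Tendsto (fun J : ℕ => ((J : ℝ) + 1) ^ a * τ J) atTop (𝓝 0)) ∧
        ∀ (J K : ℕ) (hJK : J ≤ K) (B : Set (GaugeField (F.P J) 0 (Matrix.specialUnitaryGroup (Fin 2) ℂ))), MeasurableSet B →
          B ⊆ {U | PlaqSmall (θBal F.L γ (c * b₀) p₀ J) U} →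
          gibbsK F ℰp γ K (descendTo F ℰp J K hJK ⁻¹' B) ≤
            ENNReal.ofReal (Real.exp (τ J)) * gibbsK F ℰp γ K (descendTo F ℰp J K hJK ⁻¹' B ∩ histGood F ℰp (θBal F.L γ b₀ p₀) K J)

/-- **MSTEP∘ · PER-LEVEL CONDITIONAL TAIL AFTER ONE INTERIOR CONDITIONING** (`MultiStepTailIntCan`): there is a super-polynomially small `s : ℕ → ℝ≥0` (chosen AFTER
`F, γ` — the torus exponent `F.m` is free, so only eventual smallness is asked) such that for every run `K`, every window level `J ≤ K`, every FREE level `J < j ≤ K`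
and every measurable `B` inside the INTERIOR level-`J` window: `Gibbs_K(D_{J,K}⁻¹B ∩ {level j of the run leaves W_j(b₀)}) ≤ s_j·Gibbs_K(D_{J,K}⁻¹B)` — the
conditional probability, given an interior level-`J` event, that the `(j − J)`-STEP constrained fluctuation above it has a `θ_j(b₀)`-large plaquette.  The mechanism:
the `(j−J)`-step background (iterated fibre minimiser) of an interior datum lies inside `W_j(b₀)` with room `≍ θ_j` (de-averaging ratio `C_{j−J}(L)∕L^{2(j−J)}`
against `L^{−(j−J)∕2}`), and the fluctuation around it is sub-Gaussian at scale `β_j^{−1∕2} ≪ θ_j`; entropy `Vol_j` is beaten by `e^{−cβ_jθ_j²} = e^{−c′L^j p(g_j)²∕…}`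
for `j` large, whence super-polynomial `s`.  PROVED below from MSTEP₁∘ (`j = J+1`) and DEEPSTEP∘ (`j ≥ J+2`).  WHY IT MIGHT FAIL: through its two halves.
[cite: Balaban1985UV3, (38)-(40) p.266; Balaban1985Averaging, (10) p.19 and Prop. 1; Balaban1985Variational, Thm 1 (9)-(10) p.279] -/
def MultiStepTailIntCan : Prop :=
  ∀ (L : ℕ), ∃ c₀ : ℝ, 0 < c₀ ∧ c₀ ≤ 1 ∧ ∀ (c : ℝ), 0 < c → c ≤ c₀ → ∃ pS : ℝ, ∀ (b₀ p₀ : ℝ), 0 < b₀ → pS ≤ p₀ → 0 < p₀ →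
    ∃ γ₁ : ℝ, 0 < γ₁ ∧ ∀ (F : T3Family) (γ : ℝ), F.L = L → 0 < γ → γ ≤ γ₁ →
      ∃ s : ℕ → ℝ, (∀ j, 0 ≤ s j) ∧ (∀ a : ℕ, Tendsto (fun j : ℕ => ((j : ℝ) + 1) ^ a * s j) atTop (𝓝 0)) ∧
        ∀ (J j K : ℕ) (hJK : J ≤ K) (hjK : j ≤ K), J < j →
          ∀ (B : Set (GaugeField (F.P J) 0 (Matrix.specialUnitaryGroup (Fin 2) ℂ))), MeasurableSet B →
            B ⊆ {U | PlaqSmall (θBal F.L γ (c * b₀) p₀ J) U} →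
            gibbsK F ℰp γ K (descendTo F ℰp J K hJK ⁻¹' B ∩
                {V | ¬ PlaqSmall (θBal F.L γ b₀ p₀ j) (descendTo F ℰp j K hjK V)}) ≤
              ENNReal.ofReal (s j) * gibbsK F ℰp γ K (descendTo F ℰp J K hJK ⁻¹' B)

/-- **MSTEP₁∘ · THE DEPTH-ONE ABSOLUTE TAIL — INTERIOR WINDOW, ALL RUNS, FAR FIELDS INCLUDED** (`OneStepTailIntCan`): MSTEP∘ at the first free level `j = J + 1`:
given an interior level-`J` event, the run's level `J + 1` leaves `W_{J+1}(b₀)` with conditional probability `≤ s_{J+1}`, uniformly in `K ≥ J + 1`.  On the interior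
the good history is TYPICAL in the fibre, so the natural statement is ABSOLUTE (no division by the good-history mass): the re-typed home of MOD₁∘ (moderate fields,
`Lines/tailsup_one.lean` §4e) AND of the suspended FAR₁ (critic #405 (A), decision (ii)); the moderate∕far split at a fixed `δ₀` is the hands' internal choice, served
by the LEAD's boxes D `…TailSupOneGaussianTail` (sub-Gaussian sup tail + union bound) and H `…TailSupOneFarPlaquetteCost` (`β_{J+1}(dist δ₀)²∕2` per far plaquette),
with E `…TailSupOneFibreRows` ∕ G `…ComparisonDoor` for the push-forward to the one-step fibre.  WHY IT MIGHT FAIL: the interior price — in the linearised toy the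
fibre minimiser of an interior datum stays inside `W_{J+1}(b₀)` iff `c < c_max(L) = L^{3∕2}∕C(L)` (`0.602` at L = 3, `0.926` at L = 5; FL-B j337570∕j337675); the
NONLINEAR SU(2) one-cell constant may differ by `O(θ²)` (instrument ASK (8)); and for `K > J + 1` the level-`(J+1)` marginal of the fibre measure is the one-step
fibre law tilted by the deeper effective density, whose flatness across `W_{J+1}` (WREG-type input) is used. [cite: Balaban1985UV3, (38)-(40) p.266;
Balaban1985Averaging, (10) p.19 and Prop. 1; Balaban1985Variational, Thm 1 (8)-(10) p.279] -/
def OneStepTailIntCan : Prop :=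
  ∀ (L : ℕ), ∃ c₀ : ℝ, 0 < c₀ ∧ c₀ ≤ 1 ∧ ∀ (c : ℝ), 0 < c → c ≤ c₀ → ∃ pS : ℝ, ∀ (b₀ p₀ : ℝ), 0 < b₀ → pS ≤ p₀ → 0 < p₀ →
    ∃ γ₁ : ℝ, 0 < γ₁ ∧ ∀ (F : T3Family) (γ : ℝ), F.L = L → 0 < γ → γ ≤ γ₁ →
      ∃ s : ℕ → ℝ, (∀ j, 0 ≤ s j) ∧ (∀ a : ℕ, Tendsto (fun j : ℕ => ((j : ℝ) + 1) ^ a * s j) atTop (𝓝 0)) ∧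
        ∀ (J K : ℕ) (hJK : J + 1 ≤ K)
          (B : Set (GaugeField (F.P J) 0 (Matrix.specialUnitaryGroup (Fin 2) ℂ))), MeasurableSet B →
            B ⊆ {U | PlaqSmall (θBal F.L γ (c * b₀) p₀ J) U} →
            gibbsK F ℰp γ K (descendTo F ℰp J K ((Nat.le_succ J).trans hJK) ⁻¹' B ∩
                {V | ¬ PlaqSmall (θBal F.L γ b₀ p₀ (J + 1)) (descendTo F ℰp (J + 1) K hJK V)}) ≤
              ENNReal.ofReal (s (J + 1)) * gibbsK F ℰp γ K (descendTo F ℰp J K ((Nat.le_succ J).trans hJK) ⁻¹' B)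

/-- **DEEPSTEP∘ · THE MULTI-STEP TAILS `j ≥ J + 2` — INTERIOR WINDOW, ALL RUNS** (`DeepStepTailIntCan`): MSTEP∘ at the free levels two or more steps above the
window: the `k`-STEP (`k = j − J ≥ 2`) constrained fluctuation above an interior level-`J` event has a `θ_j(b₀)`-large plaquette with conditional probability `≤ s_j`.
THE NEW OBJECT: the `k`-step de-averaging constant `C_k(L) := sup ‖ω ↦ d(k-step joint fibre minimiser)‖_{∞→∞}·L^{2k}` (linearised), conjecturally `≈ C(L^k) ≤ 15`
(R3-FLIN: `C(9) = 14.1`), to be compared with `L^{3k∕2}·Ππ` (`= 27` for `k = 2, L = 3`): the window ratio decays like `L^{−k∕2}` while the background's plaquettes decay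
like `L^{−2k}` — the margin IMPROVES with depth and needs NO interior fraction from `k = 2` on.  WHY IT MIGHT FAIL: (i) if the iterated averaging `ℰp∘ℰp` is NOT the
block-`L²` averaging (composition defect of the printed `ℰp`), `C₂(3)` is a genuinely new number — instrument row R3-FLIN-2STEP (ASK, sealed prediction `C₂(3) ∈
[11, 17]`; kill `≥ 27`); (ii) for `K > j` the level-`j` marginal of the fibre measure is tilted by the deeper effective density (WREG-type flatness used); (iii) the
uniformity in `k` of the sub-Gaussian constants (entropy `Vol_j` vs `e^{−cL^{j}…}`) is routine only once (i)–(ii) hold. [cite: Balaban1985Averaging, (10) p.19 and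
Prop. 1; Balaban1985Variational, Thm 1 (9)-(10) p.279 and Prop. 7 p.299; Balaban1985UV3, (38)-(40) p.266] -/
def DeepStepTailIntCan : Prop :=
  ∀ (L : ℕ), ∃ c₀ : ℝ, 0 < c₀ ∧ c₀ ≤ 1 ∧ ∀ (c : ℝ), 0 < c → c ≤ c₀ → ∃ pS : ℝ, ∀ (b₀ p₀ : ℝ), 0 < b₀ → pS ≤ p₀ → 0 < p₀ →
    ∃ γ₁ : ℝ, 0 < γ₁ ∧ ∀ (F : T3Family) (γ : ℝ), F.L = L → 0 < γ → γ ≤ γ₁ →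
      ∃ s : ℕ → ℝ, (∀ j, 0 ≤ s j) ∧ (∀ a : ℕ, Tendsto (fun j : ℕ => ((j : ℝ) + 1) ^ a * s j) atTop (𝓝 0)) ∧
        ∀ (J j K : ℕ) (hJK : J ≤ K) (hjK : j ≤ K), J + 2 ≤ j →
          ∀ (B : Set (GaugeField (F.P J) 0 (Matrix.specialUnitaryGroup (Fin 2) ℂ))), MeasurableSet B →
            B ⊆ {U | PlaqSmall (θBal F.L γ (c * b₀) p₀ J) U} →
            gibbsK F ℰp γ K (descendTo F ℰp J K hJK ⁻¹' B ∩
                {V | ¬ PlaqSmall (θBal F.L γ b₀ p₀ j) (descendTo F ℰp j K hjK V)}) ≤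
              ENNReal.ofReal (s j) * gibbsK F ℰp γ K (descendTo F ℰp J K hJK ⁻¹' B)

/-- **POS∘ · A DEPTH-UNIFORM POSITIVE FLOOR OF THE GOOD-HISTORY ODDS GIVEN AN INTERIOR EVENT** (`GoodHistoryPositiveIntCan`): for every window level `J` there is
`q_J > 0` (chosen after `F, γ, J` — no rate asked) with `q_J·Gibbs_K(D_{J,K}⁻¹B) ≤ Gibbs_K(D_{J,K}⁻¹B ∩ histGood(b₀) K J)` for every run `K ≥ J` and every measurable
`B` inside the interior window.  WHY A SEPARATE ROW: MSTEP∘'s `s` is only EVENTUALLY small (the torus exponent `F.m` is free after `γ₁`, so at small `j` the union bound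
over `Vol_j` plaquettes exceeds 1); the content of POS∘ is DECOUPLING across levels (a product of per-level conditional good-probabilities, each bounded below
given the good history so far, times the super-polynomial tail for large `j`) — the inductive structure of Bałaban's small-field conditioning, not a union bound.
WHY IT MIGHT FAIL: the per-level conditional good-probability given a GOOD (not interior) history up to level `j−1` is again a full-window-uniform quantity at the
intermediate levels (R3-FLIN exposure of the naive chaining at L = 3, 5): the floor must come from the multi-step picture as well (DEEPSTEP∘'s mechanism at small
`j`, with `β_j` small — the lattice is coarse there and positivity, not smallness, is asked). [cite: Balaban1985UV3, (7) p.257 and (38)-(40) p.266;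
Balaban1989LargeFieldII, (1.77)-(1.79) p.383] -/
def GoodHistoryPositiveIntCan : Prop :=
  ∀ (L : ℕ), ∃ c₀ : ℝ, 0 < c₀ ∧ c₀ ≤ 1 ∧ ∀ (c : ℝ), 0 < c → c ≤ c₀ → ∃ pS : ℝ, ∀ (b₀ p₀ : ℝ), 0 < b₀ → pS ≤ p₀ → 0 < p₀ →
    ∃ γ₁ : ℝ, 0 < γ₁ ∧ ∀ (F : T3Family) (γ : ℝ), F.L = L → 0 < γ → γ ≤ γ₁ →
      ∀ (J : ℕ), ∃ q : ℝ, 0 < q ∧ ∀ (K : ℕ) (hJK : J ≤ K)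
        (B : Set (GaugeField (F.P J) 0 (Matrix.specialUnitaryGroup (Fin 2) ℂ))), MeasurableSet B →
          B ⊆ {U | PlaqSmall (θBal F.L γ (c * b₀) p₀ J) U} →
          ENNReal.ofReal q * gibbsK F ℰp γ K (descendTo F ℰp J K hJK ⁻¹' B) ≤
            gibbsK F ℰp γ K (descendTo F ℰp J K hJK ⁻¹' B ∩ histGood F ℰp (θBal F.L γ b₀ p₀) K J)

end Rows

/-! ## §3 PROVED: MSTEP₁∘ → DEEPSTEP∘ → MSTEP∘, and MSTEP∘ → POS∘ → COND-ODDS∘ (super-polynomial tails, the union bound over the free levels, the odds step) -/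

section Analysis

/-- A non-negative super-polynomially small sequence is bounded: `(j+1)^a s_j ≤ M`. [folklore] -/
theorem exists_bound_of_tendsto_zero {u : ℕ → ℝ} (hu0 : ∀ j, 0 ≤ u j) (hu : Tendsto u atTop (𝓝 0)) : ∃ M : ℝ, 0 ≤ M ∧ ∀ j, u j ≤ M := by
  obtain ⟨N, hN⟩ := eventually_atTop.1 (hu.eventually (gt_mem_nhds one_pos))
  refine ⟨1 + ∑ j ∈ Finset.range N, u j, add_nonneg zero_le_one (Finset.sum_nonneg fun i _ => hu0 i), fun j => ?_⟩
  by_cases hj : N ≤ j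
  · have := hN j hj
    have : 0 ≤ ∑ j ∈ Finset.range N, u j := Finset.sum_nonneg fun i _ => hu0 i
    linarith
  · have hjN : j ∈ Finset.range N := Finset.mem_range.2 (lt_of_not_ge hj)
    have := Finset.single_le_sum (fun i _ => hu0 i) hjN
    linarith

/-- A non-negative super-polynomially small sequence is summable (comparison with `M∕(j+1)²`). [folklore] -/
theorem summable_of_superpoly {s : ℕ → ℝ} (hs0 : ∀ j, 0 ≤ s j) (hs : ∀ a : ℕ, Tendsto (fun j : ℕ => ((j : ℝ) + 1) ^ a * s j) atTop (𝓝 0)) :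
    Summable s := by
  obtain ⟨M, hM0, hM⟩ := exists_bound_of_tendsto_zero (fun j => by have := hs0 j; positivity) (hs 2)
  have hsum : Summable (fun j : ℕ => M * (1 / ((j : ℝ) + 1) ^ 2)) := by
    have h := (summable_nat_add_iff 1).mpr (Real.summable_one_div_nat_pow.mpr one_lt_two)
    refine (h.congr fun j => ?_).mul_left M
    push_cast; ring
  refine Summable.of_nonneg_of_le hs0 (fun j => ?_) hsum
  have hj : 0 < ((j : ℝ) + 1) ^ 2 := by positivity
  rw [mul_one_div, le_div_iff₀ hj, mul_comm]
  exact hM j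

/-- Finite partial sums over the free levels `J < j ≤ K` are bounded by the `tsum` tail from `J + 1`. [folklore] -/
theorem sum_Ico_le_tsum_tail {s : ℕ → ℝ} (hs0 : ∀ j, 0 ≤ s j) (hs : Summable s) (J K : ℕ) :
    ∑ j ∈ Finset.Ico (J + 1) (K + 1), s j ≤ ∑' k, s (k + (J + 1)) := by
  rw [Finset.sum_Ico_eq_sum_range]
  have hsh : Summable (fun k => s (k + (J + 1))) := (summable_nat_add_iff (J + 1)).mpr hs
  calc ∑ k ∈ Finset.range (K + 1 - (J + 1)), s (J + 1 + k) = ∑ k ∈ Finset.range (K + 1 - (J + 1)), s (k + (J + 1)) :=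
        Finset.sum_congr rfl fun k _ => by rw [add_comm]
    _ ≤ ∑' k, s (k + (J + 1)) := hsh.sum_le_tsum _ fun k _ => hs0 _

/-- The `tsum` tails of a non-negative super-polynomially small sequence are super-polynomially small. [folklore] -/
theorem superpoly_tsum_tail {s : ℕ → ℝ} (hs0 : ∀ j, 0 ≤ s j) (hs : ∀ a : ℕ, Tendsto (fun j : ℕ => ((j : ℝ) + 1) ^ a * s j) atTop (𝓝 0)) (a : ℕ) :
    Tendsto (fun J : ℕ => ((J : ℝ) + 1) ^ a * ∑' k, s (k + (J + 1))) atTop (𝓝 0) := by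
  -- `t j := (j+1)^a s j` is again non-negative and super-polynomially small, hence summable; its tails tend to zero
  set t : ℕ → ℝ := fun j => ((j : ℝ) + 1) ^ a * s j with ht
  have ht0 : ∀ j, 0 ≤ t j := fun j => by have := hs0 j; positivity
  have hts : ∀ b : ℕ, Tendsto (fun j : ℕ => ((j : ℝ) + 1) ^ b * t j) atTop (𝓝 0) := fun b => by
    refine (hs (b + a)).congr' (Eventually.of_forall fun j => ?_)
    simp only [ht, pow_add]; ring
  have htsum : Summable t := summable_of_superpoly ht0 hts
  have hss : Summable s := summable_of_superpoly hs0 hs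
  have htail : Tendsto (fun J : ℕ => ∑' k, t (k + (J + 1))) atTop (𝓝 0) :=
    (tendsto_sum_nat_add t).comp (tendsto_add_atTop_nat 1)
  refine squeeze_zero (fun J => mul_nonneg (by positivity) (tsum_nonneg fun k => hs0 _)) (fun J => ?_) htail
  have h1 : Summable (fun k => s (k + (J + 1))) := (summable_nat_add_iff (J + 1)).mpr hss
  have h2 : Summable (fun k => t (k + (J + 1))) := (summable_nat_add_iff (J + 1)).mpr htsum
  rw [← tsum_mul_left]
  refine Summable.tsum_le_tsum (fun k => ?_) (h1.mul_left _) h2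
  simp only [ht]
  refine mul_le_mul_of_nonneg_right ?_ (hs0 _)
  refine pow_le_pow_left₀ (by positivity) ?_ a
  push_cast; linarith [Nat.cast_nonneg (α := ℝ) k]

/-- The elementary odds step: `a ≤ g + σ·a`, `0 ≤ σ ≤ ½`, `a, g ≥ 0` ⟹ `a ≤ e^{2σ}·g` (from `1 + 2σ ≤ e^{2σ}`). [folklore] -/
theorem le_exp_mul_of_le_add {a g σ : ℝ} (ha : 0 ≤ a) (hg : 0 ≤ g) (hσ0 : 0 ≤ σ) (hσ : σ ≤ 1 / 2) (h : a ≤ g + σ * a) :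
    a ≤ Real.exp (2 * σ) * g := by
  have hE : 1 + 2 * σ ≤ Real.exp (2 * σ) := by have := Real.add_one_le_exp (2 * σ); linarith
  have h1 : 0 ≤ (Real.exp (2 * σ) - (1 + 2 * σ)) * g := mul_nonneg (by linarith) hg
  have h2 : 0 ≤ (1 + 2 * σ) * (g - (1 - σ) * a) := mul_nonneg (by linarith) (by nlinarith)
  have h3 : 0 ≤ σ * (1 - 2 * σ) * a := mul_nonneg (mul_nonneg hσ0 (by linarith)) ha
  nlinarith

end Analysis

section Doors

/-- ★ **MSTEP∘ ⟸ MSTEP₁∘ + DEEPSTEP∘** (PROVED): a free level is either the first one (`j = J + 1`) or deep (`j ≥ J + 2`); take `s := s₁ + s₂`.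
[cite: Balaban1985UV3, (38)-(40) p.266] -/
theorem multiStepTail_of_oneStep_deepStep : OneStepTailIntCan → DeepStepTailIntCan → MultiStepTailIntCan := by
  intro h1 h2 L
  obtain ⟨c₁, hc₁, hc₁1, H1⟩ := h1 L
  obtain ⟨c₂, hc₂, -, H2⟩ := h2 L
  refine ⟨min c₁ c₂, lt_min hc₁ hc₂, (min_le_left _ _).trans hc₁1, fun c hc hcle => ?_⟩
  obtain ⟨pS₁, H1⟩ := H1 c hc (hcle.trans (min_le_left _ _))
  obtain ⟨pS₂, H2⟩ := H2 c hc (hcle.trans (min_le_right _ _))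
  refine ⟨max pS₁ pS₂, fun b₀ p₀ hb hpS hp => ?_⟩
  obtain ⟨γ₁, hγ₁, H1⟩ := H1 b₀ p₀ hb ((le_max_left _ _).trans hpS) hp
  obtain ⟨γ₂, hγ₂, H2⟩ := H2 b₀ p₀ hb ((le_max_right _ _).trans hpS) hp
  refine ⟨min γ₁ γ₂, lt_min hγ₁ hγ₂, fun F γ hFL hγ hγle => ?_⟩
  obtain ⟨s₁, hs₁0, hs₁t, H1⟩ := H1 F γ hFL hγ (hγle.trans (min_le_left _ _))
  obtain ⟨s₂, hs₂0, hs₂t, H2⟩ := H2 F γ hFL hγ (hγle.trans (min_le_right _ _))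
  refine ⟨fun j => s₁ j + s₂ j, fun j => add_nonneg (hs₁0 j) (hs₂0 j), fun a => ?_, ?_⟩
  · have := (hs₁t a).add (hs₂t a)
    rw [add_zero] at this
    exact this.congr' (Eventually.of_forall fun j => by ring)
  · intro J j K hJK hjK hJj B hB hBW
    rcases Nat.lt_or_ge j (J + 2) with hj | hj
    · obtain rfl : j = J + 1 := by omega
      calc gibbsK F ℰp γ K (descendTo F ℰp J K hJK ⁻¹' B ∩ {V | ¬ PlaqSmall (θBal F.L γ b₀ p₀ (J + 1)) (descendTo F ℰp (J + 1) K hjK V)})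
            ≤ ENNReal.ofReal (s₁ (J + 1)) * gibbsK F ℰp γ K (descendTo F ℰp J K hJK ⁻¹' B) := H1 J K hjK B hB hBW
        _ ≤ ENNReal.ofReal (s₁ (J + 1) + s₂ (J + 1)) * gibbsK F ℰp γ K (descendTo F ℰp J K hJK ⁻¹' B) :=
            mul_le_mul_right' (ENNReal.ofReal_le_ofReal (le_add_of_nonneg_right (hs₂0 _))) _
    · calc gibbsK F ℰp γ K (descendTo F ℰp J K hJK ⁻¹' B ∩ {V | ¬ PlaqSmall (θBal F.L γ b₀ p₀ j) (descendTo F ℰp j K hjK V)})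
            ≤ ENNReal.ofReal (s₂ j) * gibbsK F ℰp γ K (descendTo F ℰp J K hJK ⁻¹' B) := H2 J j K hJK hjK hj B hB hBW
        _ ≤ ENNReal.ofReal (s₁ j + s₂ j) * gibbsK F ℰp γ K (descendTo F ℰp J K hJK ⁻¹' B) :=
            mul_le_mul_right' (ENNReal.ofReal_le_ofReal (le_add_of_nonneg_left (hs₁0 _))) _

/-- ★ **THE UNION BOUND OVER THE FREE LEVELS** at one `(J, K)`: if every free level `J < j ≤ K` leaves its `b₀`-window with conditional probability `≤ s_j` given the
interior level-`J` event `B`, then the bad-history part of `D_{J,K}⁻¹B` has mass `≤ (Σ_{J<j≤K} s_j)·Gibbs_K(D_{J,K}⁻¹B)` (✓`mem_histGood_iff_descendTo`; the level `j = J`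
itself is good because the interior window lies inside the full one, `0 < γ ≤ 1`, `c ≤ 1`). [cite: Balaban1985UV3, (7) p.257 and (38)-(40) p.266] -/
theorem badHistory_le_sum (F : T3Family) {γ b₀ p₀ c : ℝ} (hγ : 0 < γ) (hγ1 : γ ≤ 1) (hb : 0 < b₀) (hc1 : c ≤ 1) {J K : ℕ} (hJK : J ≤ K)
    {s : ℕ → ℝ} (hs0 : ∀ j, 0 ≤ s j) {B : Set (GaugeField (F.P J) 0 (Matrix.specialUnitaryGroup (Fin 2) ℂ))}
    (hBW : B ⊆ {U | PlaqSmall (θBal F.L γ (c * b₀) p₀ J) U})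
    (hstep : ∀ (j : ℕ) (hjK : j ≤ K), J < j →
      gibbsK F ℰp γ K (descendTo F ℰp J K hJK ⁻¹' B ∩ {V | ¬ PlaqSmall (θBal F.L γ b₀ p₀ j) (descendTo F ℰp j K hjK V)}) ≤
        ENNReal.ofReal (s j) * gibbsK F ℰp γ K (descendTo F ℰp J K hJK ⁻¹' B)) :
    gibbsK F ℰp γ K (descendTo F ℰp J K hJK ⁻¹' B ∩ (histGood F ℰp (θBal F.L γ b₀ p₀) K J)ᶜ) ≤
      ENNReal.ofReal (∑ j ∈ Finset.Ico (J + 1) (K + 1), s j) * gibbsK F ℰp γ K (descendTo F ℰp J K hJK ⁻¹' B) := by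
  set A := descendTo F ℰp J K hJK ⁻¹' B with hA
  set bad : ℕ → Set (GaugeField (F.P K) 0 (Matrix.specialUnitaryGroup (Fin 2) ℂ)) :=
    fun j => {V | ∃ hjK : j ≤ K, ¬ PlaqSmall (θBal F.L γ b₀ p₀ j) (descendTo F ℰp j K hjK V)} with hbad
  have hL1 : 1 ≤ F.L := F.hL.2.le
  -- the bad-history part is covered by the level events
  have hcover : A ∩ (histGood F ℰp (θBal F.L γ b₀ p₀) K J)ᶜ ⊆ ⋃ j ∈ Finset.Ico (J + 1) (K + 1), A ∩ bad j := by
    rintro V ⟨hVA, hVG⟩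
    rw [Set.mem_compl_iff, mem_histGood_iff_descendTo] at hVG
    push_neg at hVG
    obtain ⟨j, hJj, hjK, hj⟩ := hVG
    have hne : j ≠ J := by
      rintro rfl
      exact hj (T3PrintedMinimiserExistence.plaqSmall_of_le (θBal_mul_le hL1 hγ hγ1 hb hc1 p₀ j) (hBW hVA))
    refine Set.mem_iUnion₂.2 ⟨j, Finset.mem_Ico.2 ⟨by omega, by omega⟩, hVA, hjK, hj⟩
  calc gibbsK F ℰp γ K (A ∩ (histGood F ℰp (θBal F.L γ b₀ p₀) K J)ᶜ)
        ≤ gibbsK F ℰp γ K (⋃ j ∈ Finset.Ico (J + 1) (K + 1), A ∩ bad j) := measure_mono hcover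
    _ ≤ ∑ j ∈ Finset.Ico (J + 1) (K + 1), gibbsK F ℰp γ K (A ∩ bad j) := measure_biUnion_finset_le _ _
    _ ≤ ∑ j ∈ Finset.Ico (J + 1) (K + 1), ENNReal.ofReal (s j) * gibbsK F ℰp γ K A := by
        refine Finset.sum_le_sum fun j hj => ?_
        obtain ⟨hJj, hjK⟩ := Finset.mem_Ico.1 hj
        have hjK' : j ≤ K := by omega
        have hset : A ∩ bad j = A ∩ {V | ¬ PlaqSmall (θBal F.L γ b₀ p₀ j) (descendTo F ℰp j K hjK' V)} := by
          ext V
          simp only [hbad, Set.mem_inter_iff, Set.mem_setOf_eq]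
          exact ⟨fun ⟨h1, _, h2⟩ => ⟨h1, h2⟩, fun ⟨h1, h2⟩ => ⟨h1, hjK', h2⟩⟩
        rw [hset]
        exact hstep j hjK' (by omega)
    _ = ENNReal.ofReal (∑ j ∈ Finset.Ico (J + 1) (K + 1), s j) * gibbsK F ℰp γ K A := by
        rw [ENNReal.ofReal_sum_of_nonneg fun j _ => hs0 j, Finset.sum_mul]

/-- ★★ **COND-ODDS∘ ⟸ MSTEP∘ + POS∘** (PROVED): with `σ_J := Σ_{k} s_{k+J+1}` (super-polynomial, §3 Analysis) and the union bound, `μ(A) ≤ μ(A ∩ G) + σ_J μ(A)`; for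
`σ_J ≤ ½` this gives `μ(A) ≤ e^{2σ_J} μ(A ∩ G)`, otherwise POS∘'s floor gives `μ(A) ≤ q_J⁻¹ μ(A ∩ G)`; `τ_J := if σ_J ≤ ½ then 2σ_J else max 0 (−log q_J)` is
eventually `2σ_J`, hence super-polynomial. [cite: Balaban1985UV3, (38)-(40) p.266; Balaban1989LargeFieldII, (1.77)-(1.79) p.383] -/
theorem condGoodOddsInt_of_multiStep_pos : MultiStepTailIntCan → GoodHistoryPositiveIntCan → CondGoodOddsIntCan := by
  intro hM hP L
  obtain ⟨c₁, hc₁, hc₁1, H1⟩ := hM L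
  obtain ⟨c₂, hc₂, -, H2⟩ := hP L
  refine ⟨min c₁ c₂, lt_min hc₁ hc₂, (min_le_left _ _).trans hc₁1, fun c hc hcle => ?_⟩
  have hc1 : c ≤ 1 := (hcle.trans (min_le_left _ _)).trans hc₁1
  obtain ⟨pS₁, H1⟩ := H1 c hc (hcle.trans (min_le_left _ _))
  obtain ⟨pS₂, H2⟩ := H2 c hc (hcle.trans (min_le_right _ _))
  refine ⟨max pS₁ pS₂, fun b₀ p₀ hb hpS hp => ?_⟩
  obtain ⟨γ₁, hγ₁, H1⟩ := H1 b₀ p₀ hb ((le_max_left _ _).trans hpS) hp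
  obtain ⟨γ₂, hγ₂, H2⟩ := H2 b₀ p₀ hb ((le_max_right _ _).trans hpS) hp
  refine ⟨min (min γ₁ γ₂) 1, lt_min (lt_min hγ₁ hγ₂) one_pos, fun F γ hFL hγ hγle => ?_⟩
  have hγ1 : γ ≤ 1 := hγle.trans (min_le_right _ _)
  obtain ⟨s, hs0, hst, H1⟩ := H1 F γ hFL hγ (hγle.trans ((min_le_left _ _).trans (min_le_left _ _)))
  have H2 := H2 F γ hFL hγ (hγle.trans ((min_le_left _ _).trans (min_le_right _ _)))
  choose q hq0 hq using H2
  have hss : Summable s := summable_of_superpoly hs0 hst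
  -- the tail `σ J` and the log-odds constant `τ J`
  set σ : ℕ → ℝ := fun J => ∑' k, s (k + (J + 1)) with hσ
  have hσ0 : ∀ J, 0 ≤ σ J := fun J => tsum_nonneg fun k => hs0 _
  have hσt : ∀ a : ℕ, Tendsto (fun J : ℕ => ((J : ℝ) + 1) ^ a * σ J) atTop (𝓝 0) := fun a => superpoly_tsum_tail hs0 hst a
  set τ : ℕ → ℝ := fun J => if σ J ≤ 1 / 2 then 2 * σ J else max 0 (-Real.log (q J)) with hτ
  refine ⟨τ, fun J => ?_, fun a => ?_, fun J K hJK B hB hBW => ?_⟩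
  · simp only [hτ]
    split_ifs
    · exact mul_nonneg zero_le_two (hσ0 J)
    · exact le_max_left _ _
  · -- eventually `σ J ≤ ½`, where `τ J = 2 σ J`
    have hσ0t : Tendsto σ atTop (𝓝 0) := by simpa only [pow_zero, one_mul] using hσt 0
    have hev : ∀ᶠ J in atTop, σ J ≤ 1 / 2 := (hσ0t.eventually (ge_mem_nhds (by norm_num : (0 : ℝ) < 1 / 2)))
    have h2 : Tendsto (fun J : ℕ => 2 * (((J : ℝ) + 1) ^ a * σ J)) atTop (𝓝 0) := by
      have := (hσt a).const_mul 2
      rwa [mul_zero] at this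
    refine h2.congr' ?_
    filter_upwards [hev] with J hJ
    simp only [hτ, if_pos hJ]; ring
  · -- the setwise odds at `(J, K)`
    haveI := isProbabilityMeasure_gibbsK F ℰp hγ.le K
    set μ := gibbsK F ℰp γ K with hμ
    set A := descendTo F ℰp J K hJK ⁻¹' B with hA
    set G := histGood F ℰp (θBal F.L γ b₀ p₀) K J with hG
    have hGm : MeasurableSet G := measurableSet_histGood F ℰp measurableE_ℰp _ K J
    have hfinA : μ A ≠ ∞ := measure_ne_top μ A
    have hfinAG : μ (A ∩ G) ≠ ∞ := measure_ne_top μ _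
    by_cases hσJ : σ J ≤ 1 / 2
    · -- union bound + odds step
      have hτJ : τ J = 2 * σ J := by simp only [hτ, if_pos hσJ]
      have hbad : μ (A ∩ Gᶜ) ≤ ENNReal.ofReal (σ J) * μ A := by
        refine (badHistory_le_sum F hγ hγ1 hb hc1 hJK hs0 hBW fun j hjK hJj => H1 J j K hJK hjK hJj B hB hBW).trans ?_
        exact mul_le_mul_right' (ENNReal.ofReal_le_ofReal (sum_Ico_le_tsum_tail hs0 hss J K)) _
      have hsplit : μ A ≤ μ (A ∩ G) + ENNReal.ofReal (σ J) * μ A := by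
        calc μ A = μ (A ∩ G) + μ (A \ G) := (measure_inter_add_diff A hGm).symm
          _ ≤ μ (A ∩ G) + ENNReal.ofReal (σ J) * μ A := by rw [Set.diff_eq]; exact add_le_add le_rfl hbad
      -- pass to reals
      have ha := ENNReal.toReal_nonneg (a := μ A)
      have hg := ENNReal.toReal_nonneg (a := μ (A ∩ G))
      have hreal : (μ A).toReal ≤ (μ (A ∩ G)).toReal + σ J * (μ A).toReal := by
        have h := ENNReal.toReal_mono (ENNReal.add_ne_top.2 ⟨hfinAG, ENNReal.mul_ne_top ENNReal.ofReal_ne_top hfinA⟩) hsplit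
        rwa [ENNReal.toReal_add hfinAG (ENNReal.mul_ne_top ENNReal.ofReal_ne_top hfinA), ENNReal.toReal_mul,
          ENNReal.toReal_ofReal (hσ0 J)] at h
      have hodds := le_exp_mul_of_le_add ha hg (hσ0 J) hσJ hreal
      calc μ A = ENNReal.ofReal (μ A).toReal := (ENNReal.ofReal_toReal hfinA).symm
        _ ≤ ENNReal.ofReal (Real.exp (2 * σ J) * (μ (A ∩ G)).toReal) := ENNReal.ofReal_le_ofReal hodds
        _ = ENNReal.ofReal (Real.exp (τ J)) * μ (A ∩ G) := by
            rw [ENNReal.ofReal_mul (Real.exp_pos _).le, ENNReal.ofReal_toReal hfinAG, hτJ]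
    · -- positivity floor
      have hτJ : τ J = max 0 (-Real.log (q J)) := by simp only [hτ, if_neg hσJ]
      have hqJ := hq0 J
      have hfloor : ENNReal.ofReal (q J) * μ A ≤ μ (A ∩ G) := hq J K hJK B hB hBW
      have hexp : (q J)⁻¹ ≤ Real.exp (τ J) := by
        rw [hτJ]
        calc (q J)⁻¹ = Real.exp (-Real.log (q J)) := by rw [Real.exp_neg, Real.exp_log hqJ]
          _ ≤ Real.exp (max 0 (-Real.log (q J))) := Real.exp_le_exp.2 (le_max_right _ _)
      calc μ A = ENNReal.ofReal (q J)⁻¹ * (ENNReal.ofReal (q J) * μ A) := by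
            rw [← mul_assoc, ← ENNReal.ofReal_mul (inv_pos.2 hqJ).le, inv_mul_cancel₀ hqJ.ne', ENNReal.ofReal_one, one_mul]
        _ ≤ ENNReal.ofReal (q J)⁻¹ * μ (A ∩ G) := mul_le_mul_left' hfloor _
        _ ≤ ENNReal.ofReal (Real.exp (τ J)) * μ (A ∩ G) := mul_le_mul_right' (ENNReal.ofReal_le_ofReal hexp) _

/-! ## §4 PROVED: COND-ODDS∘ → TAILSUP∘ (✓A `…SupTailReduction` re-run on the INTERIOR window; WREG ✓`windowRegularity` for the `regSet` clause) -/

/-- ★ **THE LOG-ODDS BOUNDS AT ONE `(J, K)` ON A SUB-WINDOW** (✓A `window_logOdds_bounds` with the window profile `w` free and the good-history set `G` any measurable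
set): COND-ODDS setwise on `W := {PlaqSmall (θBal F.L γ w p₀ J)}` with constant `τ`, a continuous positive `W`-version `ρ` of `(D_{J,K})_* Gibbs_K`, `W ⊆ regSet(heightDensity^G)`
and positivity of `heightDensityCan^G` on `W` ⟹ `0 ≤ log ρ U − (−log Z_K) − log heightDensityCan^G U ≤ τ` on `W`. [cite: Balaban1985UV3, (38)-(40) p.266;
Balaban1989LargeFieldII, (1.77)-(1.79) p.383] -/
theorem subwindow_logOdds_bounds (F : T3Family) {γ : ℝ} (w p₀ : ℝ) {J K : ℕ} (hJK : J ≤ K) (hγ : 0 < γ) {τ : ℝ}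
    {G : Set (GaugeField (F.P K) 0 (Matrix.specialUnitaryGroup (Fin 2) ℂ))} (hGm : MeasurableSet G)
    (hset : ∀ B : Set (GaugeField (F.P J) 0 (Matrix.specialUnitaryGroup (Fin 2) ℂ)), MeasurableSet B →
      B ⊆ {U | PlaqSmall (θBal F.L γ w p₀ J) U} →
      gibbsK F ℰp γ K (descendTo F ℰp J K hJK ⁻¹' B) ≤ ENNReal.ofReal (Real.exp τ) * gibbsK F ℰp γ K (descendTo F ℰp J K hJK ⁻¹' B ∩ G))
    (ρ : GaugeField (F.P J) 0 (Matrix.specialUnitaryGroup (Fin 2) ℂ) → ℝ)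
    (hρpos : ∀ U, PlaqSmall (θBal F.L γ w p₀ J) U → 0 < ρ U)
    (hlaw : Measure.map (descendTo F ℰp J K hJK) (gibbsK F ℰp γ K) =
      (fieldMeasure (F.P J) 0 (Matrix.specialUnitaryGroup (Fin 2) ℂ)).withDensity (fun U => ENNReal.ofReal (ρ U)))
    (hρc : ContinuousOn ρ {U | PlaqSmall (θBal F.L γ w p₀ J) U})
    (hreg : {U : GaugeField (F.P J) 0 (Matrix.specialUnitaryGroup (Fin 2) ℂ) | PlaqSmall (θBal F.L γ w p₀ J) U} ⊆
      Node00.regSet (fieldMeasure (F.P J) 0 (Matrix.specialUnitaryGroup (Fin 2) ℂ)) (heightDensity F γ hJK G))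
    (hpos : ∀ U : GaugeField (F.P J) 0 (Matrix.specialUnitaryGroup (Fin 2) ℂ), PlaqSmall (θBal F.L γ w p₀ J) U → 0 < heightDensityCan F γ hJK G U) :
    ∀ U : GaugeField (F.P J) 0 (Matrix.specialUnitaryGroup (Fin 2) ℂ), PlaqSmall (θBal F.L γ w p₀ J) U →
      0 ≤ Real.log (ρ U) - (-Real.log (partitionFn (G := Matrix.specialUnitaryGroup (Fin 2) ℂ) (F.P K) ((F.scheme ℰp γ).β K))) -
          Real.log (heightDensityCan F γ hJK G U) ∧
      Real.log (ρ U) - (-Real.log (partitionFn (G := Matrix.specialUnitaryGroup (Fin 2) ℂ) (F.P K) ((F.scheme ℰp γ).β K))) -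
          Real.log (heightDensityCan F γ hJK G U) ≤ τ := by
  haveI := B12ContinuousTransportInvariance.isOpenPosMeasure_fieldMeasure_SU (N := 2) (F.P J) 0
  set μ := fieldMeasure (F.P J) 0 (Matrix.specialUnitaryGroup (Fin 2) ℂ) with hμ
  set W : Set (GaugeField (F.P J) 0 (Matrix.specialUnitaryGroup (Fin 2) ℂ)) := {U | PlaqSmall (θBal F.L γ w p₀ J) U} with hW
  set Z : ℝ := partitionFn (G := Matrix.specialUnitaryGroup (Fin 2) ℂ) (F.P K) ((F.scheme ℰp γ).β K) with hZ
  have hZpos : 0 < Z := partitionFn_pos' _ (F.scheme_β_nonneg ℰp hγ.le K)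
  have hWo : IsOpen W := isOpen_setOf_plaqSmall₂ (F.P J) 0 _
  have hD : Measurable (descendTo F ℰp J K hJK) := measurable_descendTo F ℰp measurableE_ℰp hJK
  -- continuity of the two canonical versions on the window
  have hEq := heightDensityCan_univ_eqOn F w p₀ hJK hγ ρ hρpos hlaw hρc
  have hcU : ContinuousOn (heightDensityCan F γ hJK Set.univ) W := (continuousOn_const.mul hρc).congr hEq
  have hcG : ContinuousOn (heightDensityCan F γ hJK G) W := by
    have : heightDensityCan F γ hJK G = Node00.canonVersion μ (heightDensity F γ hJK G) := rfl
    rw [this]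
    exact Node00.continuousOn_canonVersion.mono hreg
  -- upper: univ ≤ e^τ · G
  have hup : ∀ U ∈ W, heightDensityCan F γ hJK Set.univ U ≤ Real.exp τ * heightDensityCan F γ hJK G U := by
    refine heightDensityCan_le_of_setwise F hJK hγ MeasurableSet.univ hGm hWo (Real.exp_pos τ).le ?_ hcU hcG
    intro B hB hBW
    rw [Set.inter_univ]
    exact hset B hB hBW
  -- lower: G ≤ univ (free)
  have hlow : ∀ U ∈ W, heightDensityCan F γ hJK G U ≤ 1 * heightDensityCan F γ hJK Set.univ U := by
    refine heightDensityCan_le_of_setwise F hJK hγ hGm MeasurableSet.univ hWo zero_le_one ?_ hcG hcU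
    intro B hB _
    rw [ENNReal.ofReal_one, one_mul, Set.inter_univ]
    exact measure_mono Set.inter_subset_left
  intro U hU
  have hGpos : 0 < heightDensityCan F γ hJK G U := hpos U hU
  have hρU : 0 < ρ U := hρpos U hU
  have hUpos : 0 < heightDensityCan F γ hJK Set.univ U := lt_of_lt_of_le hGpos (by simpa only [one_mul] using hlow U hU)
  have hlogU : Real.log (ρ U) - (-Real.log Z) = Real.log (heightDensityCan F γ hJK Set.univ U) := by
    rw [show heightDensityCan F γ hJK Set.univ U = Z * ρ U from hEq hU, Real.log_mul hZpos.ne' hρU.ne']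
    ring
  rw [hlogU]
  constructor
  · have := Real.log_le_log hGpos (by simpa only [one_mul] using hlow U hU)
    linarith
  · have h1 : Real.log (heightDensityCan F γ hJK Set.univ U) ≤ Real.log (Real.exp τ * heightDensityCan F γ hJK G U) :=
      Real.log_le_log hUpos (hup U hU)
    rw [Real.log_mul (Real.exp_pos τ).ne' hGpos.ne', Real.log_exp] at h1
    linarith

/-- ★★ **TAILSUP∘ ⟸ COND-ODDS∘** (PROVED): ✓A's door on the interior window.  Inside: ✓`tower_eq_map_descendTo` (the nested law IS `(D_{J,K})_* Gibbs_K`),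
`subwindow_logOdds_bounds`, and WREG ✓`windowRegularity` at profile `b₀` for the `regSet` clause — the interior window lies inside the full one (`γ ≤ 1`, `c ≤ 1`).
[cite: Balaban1985UV3, (38)-(40) p.266; Balaban1989LargeFieldII, (1.77)-(1.79) p.383 and (1.95) p.389] -/
theorem windowOddsSupInt_of_condGoodOddsInt : CondGoodOddsIntCan → WindowOddsSupIntCan := by
  intro h L
  obtain ⟨c₀, hc₀, hc₀1, H⟩ := h L
  refine ⟨c₀, hc₀, hc₀1, fun c hc hcle => ?_⟩
  have hc1 : c ≤ 1 := hcle.trans hc₀1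
  obtain ⟨pS, hS⟩ := H c hc hcle
  refine ⟨pS, fun b₀ p₀ hb₀ hpS hp₀ => ?_⟩
  obtain ⟨γ₁, hγ₁, hF⟩ := hS b₀ p₀ hb₀ hpS hp₀
  obtain ⟨γ₂, hγ₂, hW⟩ := Summit.QuantumFields.YangMills.Theorems.FluctuationComparisonRegPrIntLWreg.windowRegularity L b₀ p₀ hb₀ hp₀
  refine ⟨min (min γ₁ γ₂) 1, lt_min (lt_min hγ₁ hγ₂) one_pos, fun F γ hFL hγ hγle => ?_⟩
  have hγ1 : γ ≤ 1 := hγle.trans (min_le_right _ _)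
  obtain ⟨τ, hτ0, hτa, hset⟩ := hF F γ hFL hγ (hγle.trans ((min_le_left _ _).trans (min_le_left _ _)))
  have hW' := hW F γ hFL hγ (hγle.trans ((min_le_left _ _).trans (min_le_right _ _)))
  refine ⟨τ, hτ0, hτa, fun ν hKK hstep J K hJK ρ hρpos hν hρc hpos => ?_⟩
  have hlaw : Measure.map (descendTo F ℰp J K hJK) (gibbsK F ℰp γ K) =
      (fieldMeasure (F.P J) 0 (Matrix.specialUnitaryGroup (Fin 2) ℂ)).withDensity (fun U => ENNReal.ofReal (ρ U)) := by
    rw [← tower_eq_map_descendTo F γ ν hKK hstep hJK]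
    exact hν
  obtain ⟨hreg, -⟩ := hW' J K hJK γ hγ
  have hL1 : 1 ≤ F.L := F.hL.2.le
  -- the interior window lies inside the full window, hence inside `regSet`
  have hsub : {U : GaugeField (F.P J) 0 (Matrix.specialUnitaryGroup (Fin 2) ℂ) | PlaqSmall (θBal F.L γ (c * b₀) p₀ J) U} ⊆
      {U | PlaqSmall (θBal F.L γ b₀ p₀ J) U} :=
    fun U hU => T3PrintedMinimiserExistence.plaqSmall_of_le (θBal_mul_le hL1 hγ hγ1 hb₀ hc1 p₀ J) hU
  exact ⟨_, subwindow_logOdds_bounds F (c * b₀) p₀ hJK hγ (measurableSet_histGood F ℰp measurableE_ℰp _ K J) (hset J K hJK) ρ hρpos hlaw hρc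
    (hsub.trans hreg) hpos⟩

end Doors

/-! ## §5 PROVED: the ∘-KNIT 1L4ᶜ∘ → H4ᶜ∘ → TAILSUP∘ → CRUDELOC → LFR♯ᶜ∘ (LINE g21-1's interpolation knit, common fraction `c := min cᵢ`, CRUDELOC at profile `c·b₀`) -/

section Knit

/-- `min x y ≤ √(x·y)` for `x, y ≥ 0`. [folklore] -/
theorem min_le_sqrt_mul {x y : ℝ} (hx : 0 ≤ x) (hy : 0 ≤ y) : min x y ≤ Real.sqrt (x * y) := by
  rcases le_total x y with h | h
  · rw [min_eq_left h]
    calc x = Real.sqrt (x ^ 2) := (Real.sqrt_sq hx).symm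
      _ ≤ Real.sqrt (x * y) := Real.sqrt_le_sqrt (by nlinarith)
  · rw [min_eq_right h]
    calc y = Real.sqrt (y ^ 2) := (Real.sqrt_sq hy).symm
      _ ≤ Real.sqrt (x * y) := Real.sqrt_le_sqrt (by nlinarith)

/-- A function whose values (shifted by a constant) lie in `[0, τ]` at the four corners has connected 4-point `≤ 2τ` in absolute value. [folklore] -/
theorem abs_fourPt_log_sub_le {X : Type*} (ρ g : X → ℝ) (c τ : ℝ) (U V W Z : X)
    (hU : 0 ≤ Real.log (ρ U) - c - Real.log (g U) ∧ Real.log (ρ U) - c - Real.log (g U) ≤ τ)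
    (hV : 0 ≤ Real.log (ρ V) - c - Real.log (g V) ∧ Real.log (ρ V) - c - Real.log (g V) ≤ τ)
    (hW : 0 ≤ Real.log (ρ W) - c - Real.log (g W) ∧ Real.log (ρ W) - c - Real.log (g W) ≤ τ)
    (hZ : 0 ≤ Real.log (ρ Z) - c - Real.log (g Z) ∧ Real.log (ρ Z) - c - Real.log (g Z) ≤ τ) :
    |fourPt (fun U => Real.log (ρ U) - Real.log (g U)) U V W Z| ≤ 2 * τ := by
  obtain ⟨hU0, hU1⟩ := hU
  obtain ⟨hV0, hV1⟩ := hV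
  obtain ⟨hW0, hW1⟩ := hW
  obtain ⟨hZ0, hZ1⟩ := hZ
  simp only [fourPt]
  rw [abs_le]
  constructor <;> linarith

/-- `|A − B| ≤ |A| + |B|`. [folklore] -/
theorem abs_sub_le_abs_add_abs (A B : ℝ) : |A - B| ≤ |A| + |B| := by
  have h := abs_add_le A (-B)
  rwa [abs_neg, ← sub_eq_add_neg] at h

/-- `√(e^{−t}) = e^{−t/2}`. [folklore] -/
theorem sqrt_exp_neg (t : ℝ) : Real.sqrt (Real.exp (-t)) = Real.exp (-(t / 2)) := by
  have h : Real.exp (-t) = Real.exp (-(t / 2)) ^ 2 := by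
    rw [sq, ← Real.exp_add]; ring_nf
  rw [h, Real.sqrt_sq (Real.exp_pos _).le]

/-- ★★★ **THE ∘-KNIT (PROVED)**: `Δ²(log ρ − log q^{hist}) = Δ²(log ρ + β𝔄) − Δ²f¹`; LOCALITY `≤ (C_J + φ₁J + φ₂J)e^{−κ₀d}` by CRUDELOC (read at profile `c·b₀`: its window IS
the interior window) and 1L4ᶜ∘(T) + H4ᶜ∘; SIZE `≤ 2τ_J` by TAILSUP∘; KNIT `min ≤ √`, `ψ J := √(2(C J + φ₁ J + φ₂ J)·τ J)`, `κ := κ₀∕2`; common fraction `c := min c₁ c₂ c₃`.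
[cite: Balaban1985UV3, (41) p.266; Balaban1989LargeFieldII, (1.95) p.389] -/
theorem largeFieldFourPtInt_of_split :
    OneLoopClusteredIntCan → BeyondOneLoopSmallIntCan → WindowOddsSupIntCan → CrudeLocalityCan → LargeFieldFourPtIntCan := by
  intro h1 h2 hT hC L
  obtain ⟨c₁, hc₁, hc₁1, H1⟩ := h1 L
  obtain ⟨c₂, hc₂, -, H2⟩ := h2 L
  obtain ⟨c₃, hc₃, -, H3⟩ := hT L
  obtain ⟨pS₄, H4⟩ := hC L
  refine ⟨min c₁ (min c₂ c₃), lt_min hc₁ (lt_min hc₂ hc₃), (min_le_left _ _).trans hc₁1, fun c hc hcle => ?_⟩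
  obtain ⟨pS₁, H1⟩ := H1 c hc (hcle.trans (min_le_left _ _))
  obtain ⟨pS₂, H2⟩ := H2 c hc (hcle.trans ((min_le_right _ _).trans (min_le_left _ _)))
  obtain ⟨pS₃, H3⟩ := H3 c hc (hcle.trans ((min_le_right _ _).trans (min_le_right _ _)))
  refine ⟨max (max pS₁ pS₂) (max pS₃ pS₄), fun b₀ p₀ hb hpS hp => ?_⟩
  have hcb : 0 < c * b₀ := mul_pos hc hb
  have hp1 : pS₁ ≤ p₀ := ((le_max_left _ _).trans (le_max_left _ _)).trans hpS
  have hp2 : pS₂ ≤ p₀ := ((le_max_right _ _).trans (le_max_left _ _)).trans hpS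
  have hp3 : pS₃ ≤ p₀ := ((le_max_left _ _).trans (le_max_right _ _)).trans hpS
  have hp4 : pS₄ ≤ p₀ := ((le_max_right _ _).trans (le_max_right _ _)).trans hpS
  obtain ⟨ε₁, hε₁, H1⟩ := H1 b₀ p₀ hb hp1 hp
  obtain ⟨ε₂, hε₂, H2⟩ := H2 b₀ p₀ hb hp2 hp
  obtain ⟨γ₃, hγ₃, H3⟩ := H3 b₀ p₀ hb hp3 hp
  -- CRUDELOC is read at the profile `c · b₀`: its window is the interior window (it carries no history)
  obtain ⟨ε₄, hε₄, H4⟩ := H4 (c * b₀) p₀ hcb hp4 hp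
  obtain ⟨ε₀, hε₀def⟩ : ∃ ε₀ : ℝ, ε₀ = min ε₁ (min ε₂ ε₄) := ⟨_, rfl⟩
  have hε₀ : 0 < ε₀ := by rw [hε₀def]; exact lt_min hε₁ (lt_min hε₂ hε₄)
  obtain ⟨γ₁, hγ₁, κ₁, hκ₁, H1⟩ := H1 ε₀ hε₀ (by rw [hε₀def]; exact min_le_left _ _)
  obtain ⟨γ₂, hγ₂, κ₂, hκ₂, H2⟩ := H2 ε₀ hε₀ (by rw [hε₀def]; exact (min_le_right _ _).trans (min_le_left _ _))
  obtain ⟨γ₄, hγ₄, κ₄, hκ₄, H4⟩ := H4 ε₀ hε₀ (by rw [hε₀def]; exact (min_le_right _ _).trans (min_le_right _ _))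
  obtain ⟨κ₀, hκ₀def⟩ : ∃ κ₀ : ℝ, κ₀ = min κ₁ (min κ₂ κ₄) := ⟨_, rfl⟩
  have hκ₀ : 0 < κ₀ := by rw [hκ₀def]; exact lt_min hκ₁ (lt_min hκ₂ hκ₄)
  have hκ₀1 : κ₀ ≤ κ₁ := by rw [hκ₀def]; exact min_le_left _ _
  have hκ₀2 : κ₀ ≤ κ₂ := by rw [hκ₀def]; exact (min_le_right _ _).trans (min_le_left _ _)
  have hκ₀4 : κ₀ ≤ κ₄ := by rw [hκ₀def]; exact (min_le_right _ _).trans (min_le_right _ _)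
  refine ⟨min (min γ₁ γ₂) (min γ₃ γ₄), lt_min (lt_min hγ₁ hγ₂) (lt_min hγ₃ hγ₄), κ₀ / 2, half_pos hκ₀,
    fun F γ hFL hγ hγle => ?_⟩
  obtain ⟨φ₁, hφ₁0, hφ₁t, H1⟩ := H1 F γ hFL hγ (hγle.trans ((min_le_left _ _).trans (min_le_left _ _)))
  obtain ⟨φ₂, hφ₂0, hφ₂t, H2⟩ := H2 F γ hFL hγ (hγle.trans ((min_le_left _ _).trans (min_le_right _ _)))
  obtain ⟨τ, hτ0, hτa, H3⟩ := H3 F γ hFL hγ (hγle.trans ((min_le_right _ _).trans (min_le_left _ _)))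
  obtain ⟨C, hC0, hCpoly, H4⟩ := H4 F γ hFL hγ (hγle.trans ((min_le_right _ _).trans (min_le_right _ _)))
  refine ⟨fun J => Real.sqrt (2 * (C J + φ₁ J + φ₂ J) * τ J), fun J => Real.sqrt_nonneg _, ?_, ?_⟩
  · -- `J·ψ J → 0`: polynomial × super-polynomial
    have hJτ : Tendsto (fun J : ℕ => (J : ℝ) * τ J) atTop (𝓝 0) := by
      have h1 : Tendsto (fun J : ℕ => ((J : ℝ) + 1) ^ 1 * τ J) atTop (𝓝 0) := hτa 1
      refine squeeze_zero (fun J => mul_nonneg (Nat.cast_nonneg J) (hτ0 J)) (fun J => ?_) h1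
      rw [pow_one]
      exact mul_le_mul_of_nonneg_right (by linarith) (hτ0 J)
    have hCτ : Tendsto (fun J : ℕ => (J : ℝ) ^ 2 * (C J * τ J)) atTop (𝓝 0) := by
      obtain ⟨a, C₀, hCle⟩ := hCpoly
      have h2 : Tendsto (fun J : ℕ => C₀ * (((J : ℝ) + 1) ^ (a + 2) * τ J)) atTop (𝓝 0) := by
        have := (hτa (a + 2)).const_mul C₀
        rwa [mul_zero] at this
      refine squeeze_zero (fun J => ?_) (fun J => ?_) h2
      · have := hC0 J; have := hτ0 J; positivity
      · have hJ1 : (J : ℝ) ^ 2 ≤ ((J : ℝ) + 1) ^ 2 := by nlinarith [Nat.cast_nonneg (α := ℝ) J]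
        calc (J : ℝ) ^ 2 * (C J * τ J) ≤ ((J : ℝ) + 1) ^ 2 * (C₀ * ((J : ℝ) + 1) ^ a * τ J) :=
              mul_le_mul hJ1 (mul_le_mul_of_nonneg_right (hCle J) (hτ0 J)) (mul_nonneg (hC0 J) (hτ0 J)) (by positivity)
          _ = C₀ * (((J : ℝ) + 1) ^ (a + 2) * τ J) := by ring
    have hφ₁τ : Tendsto (fun J : ℕ => ((J : ℝ) * φ₁ J) * ((J : ℝ) * τ J)) atTop (𝓝 0) := by
      have := hφ₁t.mul hJτ
      rwa [mul_zero] at this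
    have hφ₂τ : Tendsto (fun J : ℕ => ((J : ℝ) * φ₂ J) * ((J : ℝ) * τ J)) atTop (𝓝 0) := by
      have := hφ₂t.mul hJτ
      rwa [mul_zero] at this
    have hinner : Tendsto (fun J : ℕ => (J : ℝ) ^ 2 * (2 * (C J + φ₁ J + φ₂ J) * τ J)) atTop (𝓝 0) := by
      have h := ((hCτ.add hφ₁τ).add hφ₂τ).const_mul 2
      simp only [add_zero, mul_zero] at h
      refine h.congr' (Eventually.of_forall fun J => ?_)
      ring
    have h := hinner.sqrt
    rw [Real.sqrt_zero] at h
    refine h.congr' (Eventually.of_forall fun J => ?_)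
    show Real.sqrt ((J : ℝ) ^ 2 * (2 * (C J + φ₁ J + φ₂ J) * τ J)) = (J : ℝ) * Real.sqrt (2 * (C J + φ₁ J + φ₂ J) * τ J)
    rw [Real.sqrt_mul (sq_nonneg _), Real.sqrt_sq (Nat.cast_nonneg J)]
  · intro ν hνK hνd J K hJK ρ hρpos hνρ hρcont hgpos b b' U V W Z hU hV hW hZ hUV hUW hVZ hWZ
    obtain ⟨-, -, H1q⟩ := H1 J K hJK
    obtain ⟨-, hΛ⟩ := H1q b b' U V W Z hU hV hW hZ hUV hUW hVZ hWZ
    have hq := H2 J K hJK b b' U V W Z hU hV hW hZ hUV hUW hVZ hWZ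
    obtain ⟨a₀, ha₀⟩ := H3 ν hνK hνd J K hJK ρ hρpos hνρ hρcont hgpos
    have hl := H4 ν hνK hνd J K hJK ρ hρpos hνρ hρcont b b' U V W Z hU hV hW hZ hUV hUW hVZ hWZ
    set g : GaugeField (F.P J) 0 (Matrix.specialUnitaryGroup (Fin 2) ℂ) → ℝ :=
      fun U => heightDensityCan F γ hJK (histGood F ℰp (θBal F.L γ b₀ p₀) K J) U with hg
    set B : GaugeField (F.P J) 0 (Matrix.specialUnitaryGroup (Fin 2) ℂ) → ℝ :=
      fun U => (F.scheme ℰp γ).β K * minActionRegPr F J K hJK ε₀ U with hB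
    set Λ : ℝ := oneLoopFourPtCan F γ b₀ p₀ ε₀ hJK U V W Z with hΛdef
    set d : ℝ := (b.src.tdist b'.src : ℝ) with hd
    have hd0 : 0 ≤ d := by rw [hd]; exact Nat.cast_nonneg _
    have hf1 : fourPt (fluctAtCan F γ b₀ p₀ ε₀ hJK 1) U V W Z
        = ((Real.log (g U) + B U) - (Real.log (g V) + B V)) - ((Real.log (g W) + B W) - (Real.log (g Z) + B Z)) := by
      simp only [fourPt, fluctAtCan_one, hg, hB]
    have hsplit : fourPt (fun U => Real.log (ρ U) - Real.log (g U)) U V W Z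
        = (((Real.log (ρ U) + B U) - (Real.log (ρ V) + B V)) - ((Real.log (ρ W) + B W) - (Real.log (ρ Z) + B Z)))
          - fourPt (fluctAtCan F γ b₀ p₀ ε₀ hJK 1) U V W Z := by
      rw [hf1]; simp only [fourPt]; ring
    have e1 : Real.exp (-(κ₁ * d)) ≤ Real.exp (-(κ₀ * d)) := Real.exp_le_exp.mpr (neg_le_neg (mul_le_mul_of_nonneg_right hκ₀1 hd0))
    have e2 : Real.exp (-(κ₂ * d)) ≤ Real.exp (-(κ₀ * d)) := Real.exp_le_exp.mpr (neg_le_neg (mul_le_mul_of_nonneg_right hκ₀2 hd0))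
    have e4 : Real.exp (-(κ₄ * d)) ≤ Real.exp (-(κ₀ * d)) := Real.exp_le_exp.mpr (neg_le_neg (mul_le_mul_of_nonneg_right hκ₀4 hd0))
    have hφ₁J := hφ₁0 J
    have hφ₂J := hφ₂0 J
    have hτJ := hτ0 J
    have hCJ := hC0 J
    -- LOCALITY WITHOUT SIZE
    have hx : |fourPt (fun U => Real.log (ρ U) - Real.log (g U)) U V W Z| ≤ (C J + φ₁ J + φ₂ J) * Real.exp (-(κ₀ * d)) := by
      have htri : |fourPt (fluctAtCan F γ b₀ p₀ ε₀ hJK 1) U V W Z| ≤ |Λ| + |fourPt (fluctAtCan F γ b₀ p₀ ε₀ hJK 1) U V W Z - Λ| := by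
        have := abs_add_le Λ (fourPt (fluctAtCan F γ b₀ p₀ ε₀ hJK 1) U V W Z - Λ)
        simpa only [add_sub_cancel] using this
      rw [hsplit]
      refine (abs_sub_le_abs_add_abs _ _).trans ?_
      calc |((Real.log (ρ U) + B U) - (Real.log (ρ V) + B V)) - ((Real.log (ρ W) + B W) - (Real.log (ρ Z) + B Z))|
              + |fourPt (fluctAtCan F γ b₀ p₀ ε₀ hJK 1) U V W Z|
            ≤ C J * Real.exp (-(κ₄ * d)) + (|Λ| + |fourPt (fluctAtCan F γ b₀ p₀ ε₀ hJK 1) U V W Z - Λ|) := add_le_add hl htri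
        _ ≤ C J * Real.exp (-(κ₄ * d)) + (φ₁ J * Real.exp (-(κ₁ * d)) + φ₂ J * Real.exp (-(κ₂ * d))) :=
            add_le_add le_rfl (add_le_add hΛ hq)
        _ ≤ C J * Real.exp (-(κ₀ * d)) + (φ₁ J * Real.exp (-(κ₀ * d)) + φ₂ J * Real.exp (-(κ₀ * d))) := by
            gcongr
        _ = (C J + φ₁ J + φ₂ J) * Real.exp (-(κ₀ * d)) := by ring
    -- SIZE WITHOUT LOCALITY
    have hy : |fourPt (fun U => Real.log (ρ U) - Real.log (g U)) U V W Z| ≤ 2 * τ J :=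
      abs_fourPt_log_sub_le ρ g a₀ (τ J) U V W Z (ha₀ U hU) (ha₀ V hV) (ha₀ W hW) (ha₀ Z hZ)
    -- KNIT: min ≤ geometric mean
    have hx0 : 0 ≤ (C J + φ₁ J + φ₂ J) * Real.exp (-(κ₀ * d)) := by positivity
    have hprod : 0 ≤ 2 * (C J + φ₁ J + φ₂ J) * τ J := by positivity
    show |fourPt (fun U => Real.log (ρ U) - Real.log (g U)) U V W Z|
        ≤ Real.sqrt (2 * (C J + φ₁ J + φ₂ J) * τ J) * Real.exp (-(κ₀ / 2 * d))
    calc |fourPt (fun U => Real.log (ρ U) - Real.log (g U)) U V W Z|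
          ≤ min ((C J + φ₁ J + φ₂ J) * Real.exp (-(κ₀ * d))) (2 * τ J) := le_min hx hy
      _ ≤ Real.sqrt (((C J + φ₁ J + φ₂ J) * Real.exp (-(κ₀ * d))) * (2 * τ J)) := min_le_sqrt_mul hx0 (by positivity)
      _ = Real.sqrt ((2 * (C J + φ₁ J + φ₂ J) * τ J) * Real.exp (-(κ₀ * d))) := by congr 1; ring
      _ = Real.sqrt (2 * (C J + φ₁ J + φ₂ J) * τ J) * Real.sqrt (Real.exp (-(κ₀ * d))) := Real.sqrt_mul hprod _
      _ = Real.sqrt (2 * (C J + φ₁ J + φ₂ J) * τ J) * Real.exp (-(κ₀ / 2 * d)) := by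
          rw [sqrt_exp_neg, show -(κ₀ * d / 2) = -(κ₀ / 2 * d) by ring]

/-- ★★★ **LFR♯ᶜ∘ ⟸ 1L4ᶜ∘ + H4ᶜ∘ + CRUDELOC + MSTEP₁∘ + DEEPSTEP∘ + POS∘** (PROVED composition of §3–§5). [cite: Balaban1985UV3, (38)-(41) p.266] -/
theorem largeFieldFourPtInt_of_rows :
    OneLoopClusteredIntCan → BeyondOneLoopSmallIntCan → CrudeLocalityCan → OneStepTailIntCan → DeepStepTailIntCan → GoodHistoryPositiveIntCan →
      LargeFieldFourPtIntCan :=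
  fun h1 h2 hC hO hD hP =>
    largeFieldFourPtInt_of_split h1 h2
      (windowOddsSupInt_of_condGoodOddsInt (condGoodOddsInt_of_multiStep_pos (multiStepTail_of_oneStep_deepStep hO hD) hP)) hC

end Knit

/-! ## §6 THE STUBS (6) and the by-name concluder -/

/-- STUB 1L4ᶜ∘ (shared with LINE g21-3 `Lines/interior_table.lean`, text identical). [cite: Balaban1985Variational, Thm 1 (8)-(10) p.279] -/
theorem stub_oneLoopClusteredIntCan : OneLoopClusteredIntCan := by
  sorry

/-- STUB H4ᶜ∘ (shared with LINE g21-3, text identical). [cite: Balaban1985UV3, (45)-(47) p.267] -/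
theorem stub_beyondOneLoopSmallIntCan : BeyondOneLoopSmallIntCan := by
  sorry

/-- STUB CRUDELOC (shared with LINE g21-1 `Lines/suptail_split.lean`, text identical). [cite: Balaban1989LargeFieldII, (1.66)-(1.67) p.376] -/
theorem stub_crudeLocalityCan : CrudeLocalityCan := by
  sorry

/-- STUB MSTEP₁∘ (NEW; the depth-one absolute tail on the interior). [cite: Balaban1985UV3, (38)-(40) p.266; Balaban1985Averaging, (10) p.19] -/
theorem stub_oneStepTailIntCan : OneStepTailIntCan := by
  sorry

/-- STUB DEEPSTEP∘ (NEW; the multi-step tails, the line's lever). [cite: Balaban1985Variational, Thm 1 (9)-(10) p.279 and Prop. 7 p.299] -/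
theorem stub_deepStepTailIntCan : DeepStepTailIntCan := by
  sorry

/-- STUB POS∘ (NEW; the depth-uniform positive floor). [cite: Balaban1985UV3, (7) p.257 and (38)-(40) p.266] -/
theorem stub_goodHistoryPositiveIntCan : GoodHistoryPositiveIntCan := by
  sorry

/-- ★ **THE CONCLUDER BY NAME**: LFR♯ᶜ∘ `LargeFieldFourPtIntCan` from the six stubs. [cite: Balaban1985UV3, (41) p.266] -/
theorem largeFieldFourPtIntCan_of_stubs : LargeFieldFourPtIntCan :=
  largeFieldFourPtInt_of_rows stub_oneLoopClusteredIntCan stub_beyondOneLoopSmallIntCan stub_crudeLocalityCan stub_oneStepTailIntCan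
    stub_deepStepTailIntCan stub_goodHistoryPositiveIntCan

end Summit.QuantumFields.YangMills.Cruxes.FluctuationComparisonRegPrIntL.RunPairOrgan.MultiStepOdds

end
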